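import Summits.Ventures.HSemireg.Pad4TowerPermCovarianceStatic

/-!
# Design kernel — generic part (hsemireg-check-kernel-1 g0; req-80 block D, leg KERNEL)

HONEST FRAMING. Crux of record `…Theses.EightfoldBlochSeeds.BlochSeedDiscOne` (stmt-HodgeConjecture-18881; skeleton `Lines/birth.lean`
814a6a70c14e831a UNTOUCHED). LOGIC ONLY, no data: the machinery with which the per-support ∕ per-design modules `DesignData…`,
`DesignClassCert…` turn «design of record» facts (support, G₁-closure, multiplicities, (H1) = (A1), rank, μ) into `decide +kernel`
certificates over the tree's OWN vocabulary (`MConfig`, `MConfig.wch`, `ClassScreen`, `PermClosed`, `DeltaClosed` of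
`Pad4TowerPsiSubA1` ∕ `Pad4TowerClassScreen` ∕ `Pad4TowerPermWindow` ∕ `Pad4TowerDeltaWindow`).
* §1 raw `ℤ × ℤ` arithmetic and the raw class-tensor evaluator `rawT` of a design given as multiplicity lists; BRIDGE `wch_eq_raw`.
* §2 iterative Boolean list checkers (`allB`, `chainB`) — kernel-friendly (no recursion depth growth), with their `↔` specs.
* §3 designs as G₁-ORBIT DATA: representatives `(cell, m)` + transversal codes `i·96 + s·4 + j` (rep `i`, permutation `s`, `Δ^j`),
  packed into one natural per level (`unpack`); `permList` = the 24 elements of `S₄` as explicit `Equiv.Perm (Fin 4)` literals.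
* §4 a binary search tree over the cell key (as `Pad4TowerLineDesignCert12Closure.key`) carrying `(cell, m)`; the multiplicity FUNCTION
  `mT t : MCell → ℤ` (lookup + cell check; sound for ANY tree); from per-entry decided checks: `PermClosed` ∕ `DeltaClosed` of the level and
  GLOBAL `S₄` ∕ `Δ` invariance of `mT t`.
* §7 ORBIT TRANSPORT of the static families of record (RULE D (μ₄, M), X, A2I; tree covariance `ruleDMu4N_perm/phase`,
  `xresXFires_perm/phase`, `xresA2IFires_perm/phase`) and §8 their closure FROM ORBIT REPRESENTATIVES on a certified design
  (`ruleDMu4Closed_of_reps`, `xPlusClosed_of_reps`, `xMinusClosed_of_reps`, `a2iMinusClosed_of_reps`, `a2iPlusClosed_of_reps`; the dual-0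
  world as a LITERAL mapped configuration `cfgd` with `dual_eq`).
* §5 the class screen from 22 word representatives: `u`~`v` merging (`bphi x 1 = bphi x 2`), `S₄` (tree `wch_permW_of_permInvariant`), the
  Δ-window (tree `wch_eq_zero_of_deltaInvariant`), and a decided word-orbit cover ⇒ `classScreen_of_reps`.
Nothing here is a monad, a SOURCE, a SEED or a rung; NOTHING HERE SAYS THAT HC ∕ HC_CM ∕ HC_AV ∕ №4 ∕ 26512 ∕ 18881 ∕ H2 HOLDS OR FAILS.
`decide +kernel` only where anything is decided; no `native_decide`, no `sorry`, no `axiom`, no `instance`, no notation, no Literature fact.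
-/

set_option linter.dupNamespace false
set_option linter.unnecessarySeqFocus false
set_option maxRecDepth 4096

namespace Summit.HodgeConjecture.HodgeConjecture.Cruxes.BlochSeedDiscOne.DesignKernel

open Summit.Ventures.HSemireg Summit.Ventures.HSemireg.Pad4Tower

/-! ## §1 Raw `ℤ[i]` arithmetic and the raw class-tensor evaluator -/

/-- product of Gaussian integers written as integer pairs `(re, im)`. -/
def gmul (a b : ℤ × ℤ) : ℤ × ℤ := (a.1 * b.1 - a.2 * b.2, a.1 * b.2 + a.2 * b.1)

/-- the pair as a Gaussian integer. -/
def toG (p : ℤ × ℤ) : GaussianInt := ⟨p.1, p.2⟩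

/-- `gmul` is multiplication in `ℤ[i]`. -/
theorem toG_gmul (a b : ℤ × ℤ) : toG (gmul a b) = toG a * toG b := by
  ext
  · simp [toG, gmul, Zsqrtd.re_mul]; ring
  · simp [toG, gmul, Zsqrtd.im_mul]

/-- force an integer to constructor form before continuing (keeps kernel evaluation of long folds strict). -/
def forceInt {α : Type} (z : ℤ) (k : ℤ → α) : α :=
  match z with
  | Int.ofNat n => k (Int.ofNat n)
  | Int.negSucc n => k (Int.negSucc n)

/-- forcing does not change the value. -/
theorem forceInt_eq {α : Type} (z : ℤ) (k : ℤ → α) : forceInt z k = k z := by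
  cases z <;> rfl

/-- the letter vector `(1, α, α, β, β̄, α² − |β|²)` of a factor point as integer pairs (raw form of `bphi`). -/
def letv (x : BPoint) (l : Fin 6) : ℤ × ℤ :=
  match l.val with
  | 0 => (1, 0)
  | 1 => (x.1, 0)
  | 2 => (x.1, 0)
  | 3 => (x.2.1, x.2.2)
  | 4 => (x.2.1, -x.2.2)
  | _ => (x.1 * x.1 - x.2.1 * x.2.1 - x.2.2 * x.2.2, 0)

/-- `letv` is `bphi`, letter by letter. -/
theorem toG_letv (x : BPoint) (l : Fin 6) : toG (letv x l) = bphi x l := by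
  fin_cases l <;>
    (ext <;> simp [toG, letv, bphi, phiVec, pow_two, Zsqrtd.re_mul, Zsqrtd.im_mul, Zsqrtd.re_intCast, Zsqrtd.im_intCast])

/-- raw class tensor of one cell at a word (raw form of `MCell.ch`). -/
def chRaw (Z : MCell) (w : CWord) : ℤ × ℤ :=
  gmul (gmul (gmul (letv (Z 0) (w 0)) (letv (Z 1) (w 1))) (letv (Z 2) (w 2))) (letv (Z 3) (w 3))

/-- `chRaw` is `MCell.ch`. -/
theorem toG_chRaw (Z : MCell) (w : CWord) : toG (chRaw Z w) = Z.ch w := by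
  simp only [chRaw, toG_gmul, toG_letv, MCell.ch, chTensor]

/-- raw weighted sum `Σ m · ch(Z)(w)` over a multiplicity list, accumulator form, integers forced at every step. -/
def sumRaw (w : CWord) : List (MCell × ℤ) → ℤ → ℤ → ℤ × ℤ
  | [], s, t => (s, t)
  | (Z, m) :: L, s, t =>
    match chRaw Z w with
    | (a, b) => forceInt (s + m * a) fun s' => forceInt (t + m * b) fun t' => sumRaw w L s' t'

/-- the list sum the accumulator computes. -/
def listSum (w : CWord) (L : List (MCell × ℤ)) : GaussianInt := (L.map fun p => (p.2 : GaussianInt) * p.1.ch w).sum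

/-- the accumulator computes `(s, t) + Σ m · ch(Z)(w)`. -/
theorem toG_sumRaw (w : CWord) (L : List (MCell × ℤ)) (s t : ℤ) :
    toG (sumRaw w L s t) = toG (s, t) + listSum w L := by
  induction L generalizing s t with
  | nil => simp [sumRaw, listSum, toG]
  | cons p L ih =>
    obtain ⟨Z, m⟩ := p
    have hc : toG (chRaw Z w) = Z.ch w := toG_chRaw Z w
    simp only [sumRaw, forceInt_eq]
    rw [ih]
    simp only [listSum, List.map_cons, List.sum_cons]
    rw [← hc]
    ext
    · simp [toG]; ring
    · simp [toG]; ring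

/-- the raw class tensor of a design `(N-list, P-list)` at a word: `Σ_N m ch − Σ_P m ch`. -/
def rawT (LN LP : List (MCell × ℤ)) (w : CWord) : ℤ × ℤ :=
  match sumRaw w LN 0 0, sumRaw w LP 0 0 with
  | (a, b), (c, d) => (a - c, b - d)

/-- the raw design tensor is `Σ_N − Σ_P` of the list sums. -/
theorem toG_rawT (LN LP : List (MCell × ℤ)) (w : CWord) : toG (rawT LN LP w) = listSum w LN - listSum w LP := by
  have hN := toG_sumRaw w LN 0 0
  have hP := toG_sumRaw w LP 0 0
  have h0 : toG ((0 : ℤ), (0 : ℤ)) = 0 := by ext <;> simp [toG]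
  rw [h0, zero_add] at hN hP
  rw [← hN, ← hP]
  ext <;> simp [toG, rawT]

/-- the level of a multiplicity list as a `Finset` WITHOUT re-deduplication (the cell list is `Nodup`). -/
def levelOf (L : List (MCell × ℤ)) (hL : (L.map Prod.fst).Nodup) : Finset MCell := ⟨↑(L.map Prod.fst), by simpa using hL⟩

/-- membership in a level is membership in the cell list. -/
theorem mem_levelOf {L : List (MCell × ℤ)} {hL : (L.map Prod.fst).Nodup} {Z : MCell} : Z ∈ levelOf L hL ↔ Z ∈ L.map Prod.fst := Iff.rfl

/-- the weighted sum over a level, for ANY multiplicity function agreeing with the list on its cells, is the list sum. -/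
theorem sum_levelOf (L : List (MCell × ℤ)) (hL : (L.map Prod.fst).Nodup) (m : MCell → ℤ) (hm : ∀ p ∈ L, m p.1 = p.2) (w : CWord) :
    (∑ Z ∈ levelOf L hL, m Z • Z.ch) w = listSum w L := by
  rw [Finset.sum_apply]
  have h1 : ∑ Z ∈ levelOf L hL, (m Z • Z.ch) w = ((L.map Prod.fst).map fun Z => (m Z • Z.ch) w).sum := by
    simp only [levelOf, Finset.sum_mk, Multiset.map_coe, Multiset.sum_coe]
  rw [h1, List.map_map, listSum]
  congr 1
  refine List.map_congr_left fun p hp => ?_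
  simp only [Function.comp_apply, Pi.smul_apply, zsmul_eq_mul]
  rw [hm p hp]

/-- the configuration of a design `(N-list, P-list)`. -/
def cfgOf (LN LP : List (MCell × ℤ)) (hN : (LN.map Prod.fst).Nodup) (hP : (LP.map Prod.fst).Nodup) : MConfig :=
  ⟨levelOf LN hN, levelOf LP hP⟩

/-- **BRIDGE**: the tree's weighted class tensor of the design IS the raw evaluator, at every word, for any multiplicity functions that agree
with the lists on their cells. -/
theorem wch_eq_raw (LN LP : List (MCell × ℤ)) (hN : (LN.map Prod.fst).Nodup) (hP : (LP.map Prod.fst).Nodup)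
    (mN mP : MCell → ℤ) (hmN : ∀ p ∈ LN, mN p.1 = p.2) (hmP : ∀ p ∈ LP, mP p.1 = p.2) (w : CWord) :
    (cfgOf LN LP hN hP).wch mN mP w = toG (rawT LN LP w) := by
  rw [toG_rawT, MConfig.wch, Pi.sub_apply]
  show (∑ Z ∈ levelOf LN hN, mN Z • Z.ch) w - (∑ P ∈ levelOf LP hP, mP P • P.ch) w = _
  rw [sum_levelOf LN hN mN hmN, sum_levelOf LP hP mP hmP]

/-- the class tensor at the unit word `1111` is the RANK `Σ m_N − Σ m_P` (every cell has `ch(Z)(1111) = 1`). -/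
theorem wch_one_eq (C : MConfig) (mN mP : MCell → ℤ) :
    C.wch mN mP ![0, 0, 0, 0] = ((∑ Z ∈ C.lower, mN Z) - ∑ P ∈ C.upper, mP P : ℤ) := by
  have h1 : ∀ Z : MCell, Z.ch ![0, 0, 0, 0] = 1 := fun Z => by
    simp [MCell.ch, chTensor, bphi, phiVec]
  simp only [MConfig.wch, Pi.sub_apply, Finset.sum_apply, Pi.smul_apply]
  simp only [h1, zsmul_eq_mul, mul_one]
  push_cast
  rfl

/-- total multiplicity of a list, accumulator form. -/
def msum : List (MCell × ℤ) → ℤ → ℤ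
  | [], s => s
  | (_, m) :: L, s => forceInt (s + m) fun s' => msum L s'

/-- the accumulator computes the total multiplicity. -/
theorem msum_eq (L : List (MCell × ℤ)) (s : ℤ) : msum L s = s + (L.map Prod.snd).sum := by
  induction L generalizing s with
  | nil => simp [msum]
  | cons p L ih => obtain ⟨Z, m⟩ := p; simp [msum, forceInt_eq, ih, add_assoc]

/-- the level sum of any multiplicity function agreeing with the list is the accumulator value. -/
theorem sum_level_m (L : List (MCell × ℤ)) (hL : (L.map Prod.fst).Nodup) (m : MCell → ℤ) (hm : ∀ p ∈ L, m p.1 = p.2) :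
    ∑ Z ∈ levelOf L hL, m Z = msum L 0 := by
  have h1 : ∑ Z ∈ levelOf L hL, m Z = ((L.map Prod.fst).map m).sum := by
    simp only [levelOf, Finset.sum_mk, Multiset.map_coe, Multiset.sum_coe]
  rw [h1, List.map_map, msum_eq, zero_add]
  congr 1
  exact List.map_congr_left fun p hp => by simpa using hm p hp

/-! ## §2 Iterative Boolean list checkers -/

/-- `allB l f`: every element passes the Boolean test (tail form: the kernel loops instead of recursing). -/
def allB {α : Type} : List α → (α → Bool) → Bool
  | [], _ => true
  | x :: l, f => match f x with | true => allB l f | false => false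

/-- spec of `allB`. -/
theorem allB_iff {α : Type} (l : List α) (f : α → Bool) : allB l f = true ↔ ∀ x ∈ l, f x = true := by
  induction l with
  | nil => simp [allB]
  | cons x l ih =>
    simp only [allB, List.mem_cons, forall_eq_or_imp]
    cases hx : f x <;> simp [ih]

/-- `allB` with a decidable predicate. -/
theorem forall_of_allB {α : Type} {l : List α} {p : α → Prop} [DecidablePred p] (h : allB l (fun x => decide (p x)) = true) :
    ∀ x ∈ l, p x := fun x hx => of_decide_eq_true ((allB_iff l _).1 h x hx)

/-- strictly increasing list of naturals, tail form. -/
def chainB : List ℕ → Bool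
  | [] => true
  | [_] => true
  | a :: b :: l => match Nat.blt a b with | true => chainB (b :: l) | false => false

/-- spec of `chainB`. -/
theorem isChain_of_chainB : ∀ (l : List ℕ), chainB l = true → l.IsChain (· < ·)
  | [], _ => List.IsChain.nil
  | [a], _ => List.IsChain.singleton a
  | a :: b :: l, h => by
    simp only [chainB] at h
    cases hab : Nat.blt a b
    · rw [hab] at h; simp at h
    · rw [hab] at h
      exact List.IsChain.cons_cons (by simpa using hab) (isChain_of_chainB (b :: l) h)

/-- a list whose image under a key `k : MCell → ℕ` is strictly increasing has no duplicate cells (no injectivity needed). -/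
theorem nodup_of_keys (k : MCell → ℕ) {l : List MCell} (h : (l.map k).IsChain (· < ·)) : l.Nodup :=
  (List.pairwise_map.1 h.pairwise).imp fun hab e => by subst e; exact Nat.lt_irrefl _ hab

/-! ## §3 Designs as G₁-orbit data -/

/-- order key of a letter (as `Pad4TowerLineDesignCert12Closure.enc`): base-64 digits of the shifted coordinates. -/
def enc (x : BPoint) : ℕ := (x.1 + 16).toNat * 4096 + (x.2.1 + 16).toNat * 64 + (x.2.2 + 16).toNat
/-- order key of a cell (lexicographic in the four letters). -/
def key (Z : MCell) : ℕ := ((enc (Z 0) * 262144 + enc (Z 1)) * 262144 + enc (Z 2)) * 262144 + enc (Z 3)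

/-- an explicit permutation of `Fin 4` from its table and the inverse table. -/
def mkPerm (f g : Fin 4 → Fin 4) (h₁ : ∀ x, g (f x) = x) (h₂ : ∀ x, f (g x) = x) : Equiv.Perm (Fin 4) := ⟨f, g, h₁, h₂⟩

/-- the 24 elements of `S₄` in lexicographic order of their tables (index `s`; `(Z.perm σ) f = Z (σ f)`). -/
def permList : List (Equiv.Perm (Fin 4)) :=
  [mkPerm ![0, 1, 2, 3] ![0, 1, 2, 3] (by decide) (by decide), mkPerm ![0, 1, 3, 2] ![0, 1, 3, 2] (by decide) (by decide),
   mkPerm ![0, 2, 1, 3] ![0, 2, 1, 3] (by decide) (by decide), mkPerm ![0, 2, 3, 1] ![0, 3, 1, 2] (by decide) (by decide),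
   mkPerm ![0, 3, 1, 2] ![0, 2, 3, 1] (by decide) (by decide), mkPerm ![0, 3, 2, 1] ![0, 3, 2, 1] (by decide) (by decide),
   mkPerm ![1, 0, 2, 3] ![1, 0, 2, 3] (by decide) (by decide), mkPerm ![1, 0, 3, 2] ![1, 0, 3, 2] (by decide) (by decide),
   mkPerm ![1, 2, 0, 3] ![2, 0, 1, 3] (by decide) (by decide), mkPerm ![1, 2, 3, 0] ![3, 0, 1, 2] (by decide) (by decide),
   mkPerm ![1, 3, 0, 2] ![2, 0, 3, 1] (by decide) (by decide), mkPerm ![1, 3, 2, 0] ![3, 0, 2, 1] (by decide) (by decide),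
   mkPerm ![2, 0, 1, 3] ![1, 2, 0, 3] (by decide) (by decide), mkPerm ![2, 0, 3, 1] ![1, 3, 0, 2] (by decide) (by decide),
   mkPerm ![2, 1, 0, 3] ![2, 1, 0, 3] (by decide) (by decide), mkPerm ![2, 1, 3, 0] ![3, 1, 0, 2] (by decide) (by decide),
   mkPerm ![2, 3, 0, 1] ![2, 3, 0, 1] (by decide) (by decide), mkPerm ![2, 3, 1, 0] ![3, 2, 0, 1] (by decide) (by decide),
   mkPerm ![3, 0, 1, 2] ![1, 2, 3, 0] (by decide) (by decide), mkPerm ![3, 0, 2, 1] ![1, 3, 2, 0] (by decide) (by decide),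
   mkPerm ![3, 1, 0, 2] ![2, 1, 3, 0] (by decide) (by decide), mkPerm ![3, 1, 2, 0] ![3, 1, 2, 0] (by decide) (by decide),
   mkPerm ![3, 2, 0, 1] ![2, 3, 1, 0] (by decide) (by decide), mkPerm ![3, 2, 1, 0] ![3, 2, 1, 0] (by decide) (by decide)]

/-- `Δ^j`. -/
def deltaIter : ℕ → MCell → MCell
  | 0, Z => Z
  | j + 1, Z => (deltaIter j Z).delta

/-- force a factor point to literal form. -/
def forcePt {α : Type} (x : BPoint) (k : BPoint → α) : α :=
  forceInt x.1 fun a => forceInt x.2.1 fun b => forceInt x.2.2 fun c => k (a, b, c)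

theorem forcePt_eq {α : Type} (x : BPoint) (k : BPoint → α) : forcePt x k = k x := by
  obtain ⟨a, b, c⟩ := x; simp [forcePt, forceInt_eq]

/-- force a cell to the literal form `mcellOf x₀ x₁ x₂ x₃`. -/
def normCell {α : Type} (Z : MCell) (k : MCell → α) : α :=
  forcePt (Z 0) fun a => forcePt (Z 1) fun b => forcePt (Z 2) fun c => forcePt (Z 3) fun d => k (mcellOf a b c d)

theorem mcellOf_apply_eq (Z : MCell) : mcellOf (Z 0) (Z 1) (Z 2) (Z 3) = Z := by
  funext f; fin_cases f <;> rfl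

theorem normCell_eq {α : Type} (Z : MCell) (k : MCell → α) : normCell Z k = k Z := by
  simp only [normCell, forcePt_eq, mcellOf_apply_eq]

/-- the `(cell, m)` of a transversal code `c = i·96 + s·4 + j`: `Δ^j (R_i ∘ σ_s)` with the multiplicity of representative `i`. -/
def genCell (reps : List (MCell × ℤ)) (c : ℕ) : MCell × ℤ :=
  match reps[c / 96]?, permList[c % 96 / 4]? with
  | some (R, m), some σ => (deltaIter (c % 4) (R.perm σ), m)
  | _, _ => (fun _ => ((0 : ℤ), (0 : ℤ), (0 : ℤ)), 0)

/-- the `(cell, m)` list of a code list, every cell forced to literal form. -/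
def genList (reps : List (MCell × ℤ)) : List ℕ → List (MCell × ℤ)
  | [] => []
  | c :: cs => match genCell reps c with | (Z, m) => normCell Z fun Z' => (Z', m) :: genList reps cs

theorem genList_eq (reps : List (MCell × ℤ)) (cs : List ℕ) : genList reps cs = cs.map (genCell reps) := by
  induction cs with
  | nil => rfl
  | cons c cs ih => simp only [genList, normCell_eq, List.map_cons, ih]

/-- unpack `count` base-`B` digits of `n`, least significant first. -/
def unpack (B : ℕ) : ℕ → ℕ → List ℕ
  | 0, _ => []
  | count + 1, n => (n % B) :: unpack B count (n / B)

/-! ## §4 The search tree, the multiplicity function, closure and invariance -/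

/-- binary search tree over `key`, carrying `(cell, m)`. -/
inductive CT : Type
  | nil : CT
  | node : CT → ℕ → MCell → ℤ → CT → CT

/-- lookup by key (sound for ANY tree: a hit is an entry). -/
def CT.find : CT → ℕ → Option (MCell × ℤ)
  | CT.nil, _ => none
  | CT.node l k c m r, q =>
    match Nat.blt q k with
    | true => l.find q
    | false => match Nat.blt k q with
      | true => r.find q
      | false => some (c, m)

/-- in-order list of entries. -/
def CT.entries : CT → List (MCell × ℤ)
  | CT.nil => []
  | CT.node l _ c m r => l.entries ++ (c, m) :: r.entries

theorem CT.find_mem : ∀ (t : CT) (q : ℕ) (p : MCell × ℤ), t.find q = some p → p ∈ t.entries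
  | CT.nil, q, p, h => by simp [CT.find] at h
  | CT.node l k c m r, q, p, h => by
    simp only [CT.entries, List.mem_append, List.mem_cons]
    unfold CT.find at h
    cases h1 : Nat.blt q k
    · rw [h1] at h; simp only at h
      cases h2 : Nat.blt k q
      · rw [h2] at h; simp only [Option.some.injEq] at h; exact Or.inr (Or.inl h.symm)
      · rw [h2] at h; exact Or.inr (Or.inr (CT.find_mem r q p h))
    · rw [h1] at h; exact Or.inl (CT.find_mem l q p h)

/-- build a balanced tree from a key-sorted list (fuel = depth bound; correctness is not needed — soundness of `find` is). -/
def CT.build : ℕ → List (MCell × ℤ) → ℕ → CT × List (MCell × ℤ)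
  | 0, l, _ => (CT.nil, l)
  | fuel + 1, l, n =>
    match n with
    | 0 => (CT.nil, l)
    | n' + 1 =>
      match CT.build fuel l ((n' + 1) / 2) with
      | (lt, rest) =>
        match rest with
        | [] => (lt, [])
        | (c, m) :: rest' =>
          match CT.build fuel rest' (n' - (n' + 1) / 2) with
          | (rt, rest'') => (CT.node lt (key c) c m rt, rest'')

/-- the tree of a key-sorted `(cell, m)` list. -/
def treeOf (L : List (MCell × ℤ)) : CT := (CT.build 64 L L.length).1

/-- THE MULTIPLICITY FUNCTION of a tree: the stored multiplicity if the stored cell IS the query, else `0`. -/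
def mT (t : CT) (Z : MCell) : ℤ :=
  match t.find (key Z) with
  | some (c, m) => match decide (c = Z) with | true => m | false => 0
  | none => 0

/-- soundness: a non-zero value is a stored entry for the query cell. -/
theorem mT_entry {t : CT} {Z : MCell} (h : mT t Z ≠ 0) : (Z, mT t Z) ∈ t.entries := by
  unfold mT at h ⊢
  cases hf : t.find (key Z) with
  | none => rw [hf] at h; exact absurd rfl h
  | some p =>
    obtain ⟨c, m⟩ := p
    rw [hf] at h
    by_cases hcZ : c = Z
    · subst hcZ
      simp only
      exact CT.find_mem t _ _ hf
    · have hc : decide (c = Z) = false := decide_eq_false hcZ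
      simp only [hc] at h
      exact absurd rfl h

/-- `S₄`-invariance of a multiplicity function, as a predicate on `σ`. -/
def PInv (m : MCell → ℤ) (σ : Equiv.Perm (Fin 4)) : Prop := ∀ Z, m (Z.perm σ) = m Z

theorem pInv_one (m : MCell → ℤ) : PInv m 1 := fun Z => by rw [MCell.perm_one]

theorem pInv_mul {m : MCell → ℤ} {σ τ : Equiv.Perm (Fin 4)} (hσ : PInv m σ) (hτ : PInv m τ) : PInv m (σ * τ) := fun Z => by
  rw [MCell.perm_mul, hτ, hσ]

/-- every transposition of `Fin 4` is pointwise one of `(01) (12) (23) (02) (13) (03)`. [`decide`] -/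
theorem swap_cases : ∀ x y : Fin 4, x ≠ y →
    (∀ z, Equiv.swap x y z = Equiv.swap 0 1 z) ∨ (∀ z, Equiv.swap x y z = Equiv.swap 1 2 z) ∨ (∀ z, Equiv.swap x y z = Equiv.swap 2 3 z) ∨
    (∀ z, Equiv.swap x y z = Equiv.swap 0 2 z) ∨ (∀ z, Equiv.swap x y z = Equiv.swap 1 3 z) ∨ (∀ z, Equiv.swap x y z = Equiv.swap 0 3 z) := by
  decide

/-- `S₄`-invariance from invariance under the three adjacent transpositions. -/
theorem pInv_all {m : MCell → ℤ} (h01 : PInv m (Equiv.swap 0 1)) (h12 : PInv m (Equiv.swap 1 2)) (h23 : PInv m (Equiv.swap 2 3)) :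
    ∀ σ, PInv m σ := by
  have e02 : Equiv.swap (0 : Fin 4) 2 = Equiv.swap 0 1 * Equiv.swap 1 2 * Equiv.swap 0 1 := Equiv.ext (by decide)
  have e13 : Equiv.swap (1 : Fin 4) 3 = Equiv.swap 1 2 * Equiv.swap 2 3 * Equiv.swap 1 2 := Equiv.ext (by decide)
  have e03 : Equiv.swap (0 : Fin 4) 3 = Equiv.swap 0 1 * Equiv.swap 1 3 * Equiv.swap 0 1 := Equiv.ext (by decide)
  have h02 : PInv m (Equiv.swap 0 2) := by rw [e02]; exact pInv_mul (pInv_mul h01 h12) h01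
  have h13 : PInv m (Equiv.swap 1 3) := by rw [e13]; exact pInv_mul (pInv_mul h12 h23) h12
  have h03 : PInv m (Equiv.swap 0 3) := by rw [e03]; exact pInv_mul (pInv_mul h01 h13) h01
  have hsw : ∀ x y : Fin 4, x ≠ y → PInv m (Equiv.swap x y) := by
    intro x y hxy
    rcases swap_cases x y hxy with e | e | e | e | e | e <;> rw [Equiv.ext e]
    exacts [h01, h12, h23, h02, h13, h03]
  intro σ
  induction σ using Equiv.Perm.swap_induction_on with
  | one => exact pInv_one m
  | swap_mul τ x y hxy ih => exact pInv_mul (hsw x y hxy) ih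

/-- the three adjacent transpositions as explicit table permutations (cheap to apply in the kernel). -/
def sw01 : Equiv.Perm (Fin 4) := mkPerm ![1, 0, 2, 3] ![1, 0, 2, 3] (by decide) (by decide)
/-- see `sw01`. -/
def sw12 : Equiv.Perm (Fin 4) := mkPerm ![0, 2, 1, 3] ![0, 2, 1, 3] (by decide) (by decide)
/-- see `sw01`. -/
def sw23 : Equiv.Perm (Fin 4) := mkPerm ![0, 1, 3, 2] ![0, 1, 3, 2] (by decide) (by decide)

theorem sw01_eq : sw01 = Equiv.swap 0 1 := Equiv.ext (by decide)
theorem sw12_eq : sw12 = Equiv.swap 1 2 := Equiv.ext (by decide)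
theorem sw23_eq : sw23 = Equiv.swap 2 3 := Equiv.ext (by decide)

/-- the per-entry CLOSURE CHECK of a level: the entry's own lookup, its three adjacent transposition images and its `Δ`-image all return
the entry's multiplicity. -/
def closureCheck (t : CT) (p : MCell × ℤ) : Bool :=
  decide (mT t p.1 = p.2) && decide (mT t (p.1.perm sw01) = p.2) && decide (mT t (p.1.perm sw12) = p.2) &&
    decide (mT t (p.1.perm sw23) = p.2) && decide (mT t p.1.delta = p.2)

/-- what the closure check says. -/
theorem closureCheck_spec {t : CT} {p : MCell × ℤ} (h : closureCheck t p = true) :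
    mT t p.1 = p.2 ∧ mT t (p.1.perm (Equiv.swap 0 1)) = p.2 ∧ mT t (p.1.perm (Equiv.swap 1 2)) = p.2 ∧
      mT t (p.1.perm (Equiv.swap 2 3)) = p.2 ∧ mT t p.1.delta = p.2 := by
  simp only [closureCheck, Bool.and_eq_true, decide_eq_true_eq, sw01_eq, sw12_eq, sw23_eq] at h
  exact ⟨h.1.1.1.1, h.1.1.1.2, h.1.1.2, h.1.2, h.2⟩

/-- A CERTIFIED LEVEL: a `(cell, m)` list `L` and a tree `t` with `t.entries = L`, all multiplicities positive, every entry passing the closure check. -/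
structure LevelCert (L : List (MCell × ℤ)) (t : CT) : Prop where
  entries : t.entries = L
  pos : ∀ p ∈ L, 0 < p.2
  closed : ∀ p ∈ L, closureCheck t p = true

namespace LevelCert

variable {L : List (MCell × ℤ)} {t : CT}

theorem agree (h : LevelCert L t) : ∀ p ∈ L, mT t p.1 = p.2 := fun p hp => (closureCheck_spec (h.closed p hp)).1

theorem entry_of_ne (h : LevelCert L t) {Z : MCell} (hZ : mT t Z ≠ 0) : (Z, mT t Z) ∈ L := h.entries ▸ mT_entry hZ

theorem ne_zero_iff_mem (h : LevelCert L t) (Z : MCell) : mT t Z ≠ 0 ↔ Z ∈ L.map Prod.fst := by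
  constructor
  · intro hZ; exact List.mem_map.2 ⟨_, h.entry_of_ne hZ, rfl⟩
  · rintro hZ
    obtain ⟨p, hp, rfl⟩ := List.mem_map.1 hZ
    rw [h.agree p hp]; exact (h.pos p hp).ne'

/-- on the support the multiplicity function takes the listed (non-zero) values, so a closure equation transports. -/
theorem transport (h : LevelCert L t) (g : MCell → MCell) (hcl : ∀ p ∈ L, mT t (g p.1) = p.2) (W : MCell) (hW : mT t W ≠ 0) :
    mT t (g W) = mT t W := by
  have e := hcl (W, mT t W) (h.entry_of_ne hW)
  exact e

/-- invariance under an involution `s` checked on the entries (for ALL cells). -/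
theorem pInv_of_check (h : LevelCert L t) (s : Equiv.Perm (Fin 4)) (hs : s * s = 1)
    (hcl : ∀ p ∈ L, mT t (p.1.perm s) = p.2) : PInv (mT t) s := by
  have hinv : ∀ Z : MCell, (Z.perm s).perm s = Z := fun Z => by rw [← MCell.perm_mul, hs, MCell.perm_one]
  intro Z
  by_cases hZ : mT t Z = 0
  · rw [hZ]
    by_contra hne
    have h1 := h.transport (fun W => W.perm s) hcl (Z.perm s) hne
    simp only [hinv] at h1
    rw [hZ] at h1
    exact hne h1.symm
  · exact h.transport (fun W => W.perm s) hcl Z hZ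

/-- **GLOBAL `S₄`-INVARIANCE of the multiplicity function.** -/
theorem pInv (h : LevelCert L t) : ∀ σ Z, mT t (MCell.perm σ Z) = mT t Z :=
  pInv_all
    (h.pInv_of_check (Equiv.swap 0 1) (Equiv.swap_mul_self 0 1) fun p hp => (closureCheck_spec (h.closed p hp)).2.1)
    (h.pInv_of_check (Equiv.swap 1 2) (Equiv.swap_mul_self 1 2) fun p hp => (closureCheck_spec (h.closed p hp)).2.2.1)
    (h.pInv_of_check (Equiv.swap 2 3) (Equiv.swap_mul_self 2 3) fun p hp => (closureCheck_spec (h.closed p hp)).2.2.2.1)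

/-- **GLOBAL `Δ`-INVARIANCE of the multiplicity function.** -/
theorem dInv (h : LevelCert L t) : ∀ Z, mT t Z.delta = mT t Z := by
  have hcl : ∀ p ∈ L, mT t p.1.delta = p.2 := fun p hp => (closureCheck_spec (h.closed p hp)).2.2.2.2
  have tr := h.transport MCell.delta hcl
  intro Z
  by_cases hZ : mT t Z = 0
  · rw [hZ]
    by_contra hne
    have h1 : mT t Z.delta.delta = mT t Z.delta := tr _ hne
    have h2 : mT t Z.delta.delta.delta = mT t Z.delta.delta := tr _ (by rw [h1]; exact hne)
    have h3 : mT t Z.delta.delta.delta.delta = mT t Z.delta.delta.delta := tr _ (by rw [h2, h1]; exact hne)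
    rw [MCell.delta_four, h2, h1, hZ] at h3
    exact hne h3.symm
  · exact tr Z hZ

theorem nodup_of (hk : ((L.map Prod.fst).map key).IsChain (· < ·)) : (L.map Prod.fst).Nodup := nodup_of_keys key hk

/-- the level is `S₄`-closed. -/
theorem permClosed (h : LevelCert L t) (hL : (L.map Prod.fst).Nodup) : PermClosed (levelOf L hL) := by
  intro σ Z hZ
  rw [mem_levelOf] at hZ ⊢
  rw [← h.ne_zero_iff_mem] at hZ ⊢
  rwa [h.pInv σ Z]

/-- the level is `Δ`-closed. -/
theorem deltaClosed (h : LevelCert L t) (hL : (L.map Prod.fst).Nodup) : DeltaClosed (levelOf L hL) := by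
  intro Z hZ
  rw [mem_levelOf] at hZ ⊢
  rw [← h.ne_zero_iff_mem] at hZ ⊢
  rwa [h.dInv Z]

end LevelCert

/-- `LevelCert` from the three decided Booleans. -/
theorem levelCert_of (L : List (MCell × ℤ)) (t : CT) (h1 : t.entries = L) (h2 : allB L (fun p => decide (0 < p.2)) = true)
    (h3 : allB L (closureCheck t) = true) : LevelCert L t :=
  ⟨h1, forall_of_allB h2, (allB_iff L _).1 h3⟩

/-! ## §5 The class screen from 22 word representatives -/

/-- merge the letter `v` into `u` (`bphi x 2 = bphi x 1 = α`). -/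
def uvNorm (w : CWord) : CWord := fun f => if w f = 2 then 1 else w f

theorem bphi_uv (x : BPoint) (l : Fin 6) : bphi x (if l = 2 then 1 else l) = bphi x l := by
  by_cases h : l = 2
  · subst h; simp [bphi, phiVec]
  · rw [if_neg h]

theorem ch_uvNorm (Z : MCell) (w : CWord) : Z.ch (uvNorm w) = Z.ch w := by
  simp only [MCell.ch, chTensor, uvNorm, bphi_uv]

theorem wch_uvNorm (C : MConfig) (mN mP : MCell → ℤ) (w : CWord) : C.wch mN mP (uvNorm w) = C.wch mN mP w := by
  simp only [MConfig.wch, Pi.sub_apply, Finset.sum_apply, Pi.smul_apply, ch_uvNorm]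

theorem ldeg_uv (l : Fin 6) : ldeg (if l = 2 then 1 else l) = ldeg l := by
  by_cases h : l = 2
  · subst h; decide
  · rw [if_neg h]

theorem wdeg_uvNorm (w : CWord) : wdeg (uvNorm w) = wdeg w := by
  simp only [wdeg, uvNorm, ldeg_uv]

/-- the 7 e-MIXED word representatives with `n_e = n_ē` (letters `0,1,3,4,5 = 1,u,e,ē,p`): `eē11, eē1u, eē1p, eēuu, eēup, eēpp, eeēē`. -/
def mixedReps : List CWord :=
  [![3, 4, 0, 0], ![3, 4, 0, 1], ![3, 4, 0, 5], ![3, 4, 1, 1], ![3, 4, 1, 5], ![3, 4, 5, 5], ![3, 3, 4, 4]]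

/-- the 15 e-FREE word representatives (multisets of size 4 from `{1, u, p}`). -/
def freeReps : List CWord :=
  [![0, 0, 0, 0], ![1, 0, 0, 0], ![1, 1, 0, 0], ![1, 1, 1, 0], ![1, 1, 1, 1], ![5, 0, 0, 0], ![5, 1, 0, 0], ![5, 1, 1, 0],
   ![5, 1, 1, 1], ![5, 5, 0, 0], ![5, 5, 1, 0], ![5, 5, 1, 1], ![5, 5, 5, 0], ![5, 5, 5, 1], ![5, 5, 5, 5]]

/-- Boolean cover test: some `S₄`-rearrangement of the `u`~`v`-merged word is one of the representatives. -/
def coverB (reps : List CWord) (w : CWord) : Bool :=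
  permList.any fun σ => reps.any fun r => decide (r = permW σ (uvNorm w))

theorem cover_of_coverB {reps : List CWord} {w : CWord} (h : coverB reps w = true) : ∃ σ ∈ permList, permW σ (uvNorm w) ∈ reps := by
  simp only [coverB, List.any_eq_true, decide_eq_true_eq] at h
  obtain ⟨σ, hσ, r, hr, rfl⟩ := h
  exact ⟨σ, hσ, hr⟩

/-- WORD-ORBIT COVER, mixed part: every e-mixed word other than `eeee`, `ēēēē` with trivial Δ-twist is, after `u`~`v` merging, an
`S₄`-rearrangement of one of the 7 mixed representatives. [kernel, `decide`] -/
theorem mixed_coverB : ∀ w : CWord, ¬ EFree w → w ≠ eWord → w ≠ ebarWord → wtwExp w % 4 = 0 → coverB mixedReps w = true := by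
  decide +kernel

theorem mixed_cover (w : CWord) (h1 : ¬ EFree w) (h2 : w ≠ eWord) (h3 : w ≠ ebarWord) (h4 : wtwExp w % 4 = 0) :
    ∃ σ ∈ permList, permW σ (uvNorm w) ∈ mixedReps := cover_of_coverB (mixed_coverB w h1 h2 h3 h4)

/-- WORD-ORBIT COVER, free part: every e-free word is, after `u`~`v` merging, an `S₄`-rearrangement of one of the 15 free
representatives. [kernel, `decide`] -/
theorem free_coverB : ∀ w : CWord, EFree w → coverB freeReps w = true := by
  decide +kernel

theorem free_cover (w : CWord) (h : EFree w) : ∃ σ ∈ permList, permW σ (uvNorm w) ∈ freeReps := cover_of_coverB (free_coverB w h)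

/-- **(A1) FROM 22 REPRESENTATIVE WORDS.** On a `G₁`-closed support with `G₁`-invariant multiplicities, the weighted class tensor passes
the class screen as soon as the 7 mixed representatives vanish and the 15 free representatives depend only on the degree. -/
theorem classScreen_of_reps (C : MConfig) (mN mP : MCell → ℤ)
    (hlP : PermClosed C.lower) (huP : PermClosed C.upper) (hlD : DeltaClosed C.lower) (huD : DeltaClosed C.upper)
    (hNσ : ∀ σ Z, mN (MCell.perm σ Z) = mN Z) (hPσ : ∀ σ P, mP (MCell.perm σ P) = mP P)
    (hNΔ : ∀ Z, mN Z.delta = mN Z) (hPΔ : ∀ P, mP P.delta = mP P) (q : ℕ → GaussianInt)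
    (hmixed : ∀ r ∈ mixedReps, C.wch mN mP r = 0) (hfree : ∀ r ∈ freeReps, C.wch mN mP r = q (wdeg r)) :
    ClassScreen (C.wch mN mP) := by
  have hval : ∀ w, EFree w → C.wch mN mP w = q (wdeg w) := by
    intro w hw
    obtain ⟨σ, -, hr⟩ := free_cover w hw
    rw [← wch_uvNorm, ← C.wch_permW_of_permInvariant hlP huP mN mP hNσ hPσ σ (uvNorm w), hfree _ hr, wdeg_permW, wdeg_uvNorm]
  refine ⟨fun w h1 h2 h3 => ?_, fun w w' hw hw' hd => by rw [hval w hw, hval w' hw', hd]⟩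
  by_cases ht : wtwExp w % 4 = 0
  · obtain ⟨σ, -, hr⟩ := mixed_cover w h1 h2 h3 ht
    rw [← wch_uvNorm, ← C.wch_permW_of_permInvariant hlP huP mN mP hNσ hPσ σ (uvNorm w), hmixed _ hr]
  · exact C.wch_eq_zero_of_deltaInvariant hlD huD mN mP hNΔ hPΔ w (by rw [Ne, twistW_eq_one_iff]; exact ht)

/-! ## §6 The certified design: everything assembled -/

/-- A CERTIFIED DESIGN: two certified levels with key-sorted cell lists. -/
structure DesignCert (LN LP : List (MCell × ℤ)) (tN tP : CT) : Prop where
  certN : LevelCert LN tN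
  certP : LevelCert LP tP
  keysN : ((LN.map Prod.fst).map key).IsChain (· < ·)
  keysP : ((LP.map Prod.fst).map key).IsChain (· < ·)

namespace DesignCert

variable {LN LP : List (MCell × ℤ)} {tN tP : CT}

theorem nodupN (h : DesignCert LN LP tN tP) : (LN.map Prod.fst).Nodup := nodup_of_keys key h.keysN
theorem nodupP (h : DesignCert LN LP tN tP) : (LP.map Prod.fst).Nodup := nodup_of_keys key h.keysP

/-- the configuration of the certified design. -/
def cfg (h : DesignCert LN LP tN tP) : MConfig := cfgOf LN LP h.nodupN h.nodupP

theorem cfg_lower (h : DesignCert LN LP tN tP) : h.cfg.lower = levelOf LN h.nodupN := rfl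
theorem cfg_upper (h : DesignCert LN LP tN tP) : h.cfg.upper = levelOf LP h.nodupP := rfl
theorem mem_lower (h : DesignCert LN LP tN tP) {Z : MCell} : Z ∈ h.cfg.lower ↔ Z ∈ LN.map Prod.fst := Iff.rfl
theorem mem_upper (h : DesignCert LN LP tN tP) {P : MCell} : P ∈ h.cfg.upper ↔ P ∈ LP.map Prod.fst := Iff.rfl

/-- the support is `G₁`-closed: both levels `S₄`-closed and `Δ`-closed. -/
theorem g1 (h : DesignCert LN LP tN tP) :
    PermClosed h.cfg.lower ∧ PermClosed h.cfg.upper ∧ DeltaClosed h.cfg.lower ∧ DeltaClosed h.cfg.upper :=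
  ⟨h.certN.permClosed h.nodupN, h.certP.permClosed h.nodupP, h.certN.deltaClosed h.nodupN, h.certP.deltaClosed h.nodupP⟩

/-- the weighted class tensor of the certified design IS the raw evaluator. -/
theorem wch_eq (h : DesignCert LN LP tN tP) (w : CWord) : h.cfg.wch (mT tN) (mT tP) w = toG (rawT LN LP w) :=
  wch_eq_raw LN LP h.nodupN h.nodupP (mT tN) (mT tP) h.certN.agree h.certP.agree w

/-- **(A1) for the certified design from the 22 raw word checks.** -/
theorem classScreen (h : DesignCert LN LP tN tP) (qr : ℕ → ℤ × ℤ)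
    (hmixed : ∀ r ∈ mixedReps, rawT LN LP r = (0, 0)) (hfree : ∀ r ∈ freeReps, rawT LN LP r = qr (wdeg r)) :
    ClassScreen (h.cfg.wch (mT tN) (mT tP)) := by
  obtain ⟨h1, h2, h3, h4⟩ := h.g1
  refine classScreen_of_reps h.cfg (mT tN) (mT tP) h1 h2 h3 h4 h.certN.pInv h.certP.pInv h.certN.dInv h.certP.dInv
    (fun k => toG (qr k)) (fun r hr => ?_) (fun r hr => ?_)
  · rw [h.wch_eq, hmixed r hr]; rfl
  · rw [h.wch_eq, hfree r hr]

/-- **μ** of the certified design from the raw check at `eeee`. -/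
theorem mu (h : DesignCert LN LP tN tP) (a b : ℤ) (he : rawT LN LP eWord = (a, b)) : h.cfg.wch (mT tN) (mT tP) eWord = ⟨a, b⟩ := by
  rw [h.wch_eq, he]; rfl

/-- **RANK** of the certified design: `Σ m_N − Σ m_P` from the two accumulator totals. -/
theorem rank (h : DesignCert LN LP tN tP) :
    ((∑ Z ∈ h.cfg.lower, mT tN Z) - ∑ P ∈ h.cfg.upper, mT tP P : ℤ) = msum LN 0 - msum LP 0 := by
  rw [cfg_lower, cfg_upper, sum_level_m LN h.nodupN _ h.certN.agree, sum_level_m LP h.nodupP _ h.certP.agree]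

/-- every multiplicity is positive on the support and zero off it. -/
theorem mult_pos (h : DesignCert LN LP tN tP) :
    (∀ Z ∈ h.cfg.lower, 0 < mT tN Z) ∧ (∀ P ∈ h.cfg.upper, 0 < mT tP P) ∧
      (∀ Z, Z ∉ h.cfg.lower → mT tN Z = 0) ∧ (∀ P, P ∉ h.cfg.upper → mT tP P = 0) := by
  refine ⟨fun Z hZ => ?_, fun P hP => ?_, fun Z hZ => ?_, fun P hP => ?_⟩
  · obtain ⟨p, hp, rfl⟩ := List.mem_map.1 (h.mem_lower.1 hZ); rw [h.certN.agree p hp]; exact h.certN.pos p hp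
  · obtain ⟨p, hp, rfl⟩ := List.mem_map.1 (h.mem_upper.1 hP); rw [h.certP.agree p hp]; exact h.certP.pos p hp
  · by_contra hne; exact hZ (h.mem_lower.2 ((h.certN.ne_zero_iff_mem Z).1 hne))
  · by_contra hne; exact hP (h.mem_upper.2 ((h.certP.ne_zero_iff_mem P).1 hne))

end DesignCert

/-- `DesignCert` from six decided Booleans. -/
theorem designCert_of (LN LP : List (MCell × ℤ)) (tN tP : CT)
    (h1 : tN.entries = LN) (h2 : allB LN (fun p => decide (0 < p.2)) = true) (h3 : allB LN (closureCheck tN) = true)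
    (h4 : tP.entries = LP) (h5 : allB LP (fun p => decide (0 < p.2)) = true) (h6 : allB LP (closureCheck tP) = true)
    (h7 : chainB ((LN.map Prod.fst).map key) = true) (h8 : chainB ((LP.map Prod.fst).map key) = true) : DesignCert LN LP tN tP :=
  ⟨levelCert_of LN tN h1 h2 h3, levelCert_of LP tP h4 h5 h6, isChain_of_chainB _ h7, isChain_of_chainB _ h8⟩

/-! ## §7 Orbit transport of the static families of record (tree covariance: `Pad4TowerPermCovariance(Static)`, `Pad4TowerTorusBlind(Base)`) -/

/-- a perm-closed configuration is its own permutation image. -/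
theorem permImage_eq_of_permClosed (C : MConfig) (hl : PermClosed C.lower) (hu : PermClosed C.upper) (τ : Equiv.Perm (Fin 4)) :
    C.permImage τ = C := by
  obtain ⟨lo, up⟩ := C
  show MConfig.mk _ _ = _
  rw [image_perm_eq _ hl, image_perm_eq _ hu]

/-- a Δ-closed configuration is its own `dVec` phase image. -/
theorem phaseImage_eq_of_deltaClosed (C : MConfig) (hl : DeltaClosed C.lower) (hu : DeltaClosed C.upper) :
    C.phaseImage dVec = C := MConfig.phaseImage_dVec_of_deltaClosed C hl hu

/-- a `G₁`-closed configuration (the four closure facts). -/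
abbrev G1C (C : MConfig) : Prop := PermClosed C.lower ∧ PermClosed C.upper ∧ DeltaClosed C.lower ∧ DeltaClosed C.upper

/-! ### RULE D -/

theorem ruleDMu4N_perm_of (C : MConfig) (hG : G1C C) (τ : Equiv.Perm (Fin 4)) (Z : MCell) (h : RuleDMu4N C Z) : RuleDMu4N C (Z.perm τ) := by
  have e := ruleDMu4N_perm τ C Z
  rw [permImage_eq_of_permClosed C hG.1 hG.2.1] at e
  exact e.2 h

theorem ruleDMu4N_delta_of (C : MConfig) (hG : G1C C) (Z : MCell) (h : RuleDMu4N C Z) : RuleDMu4N C Z.delta := by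
  have e := ruleDMu4N_phase dVec C Z
  rw [phaseImage_eq_of_deltaClosed C hG.2.2.1 hG.2.2.2, MCell.phase_dVec] at e
  exact e.2 h

theorem ruleDMu4N_orbit (C : MConfig) (hG : G1C C) (R : MCell) (h : RuleDMu4N C R) (τ : Equiv.Perm (Fin 4)) :
    ∀ j, RuleDMu4N C (deltaIter j (R.perm τ))
  | 0 => ruleDMu4N_perm_of C hG τ R h
  | j + 1 => ruleDMu4N_delta_of C hG _ (ruleDMu4N_orbit C hG R h τ j)

theorem ruleDMu4P_perm_of (C : MConfig) (hG : G1C C) (τ : Equiv.Perm (Fin 4)) (P : MCell) (h : RuleDMu4P C P) : RuleDMu4P C (P.perm τ) := by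
  have e := ruleDMu4P_perm τ C P
  rw [permImage_eq_of_permClosed C hG.1 hG.2.1] at e
  exact e.2 h

theorem ruleDMu4P_delta_of (C : MConfig) (hG : G1C C) (P : MCell) (h : RuleDMu4P C P) : RuleDMu4P C P.delta := by
  have e := ruleDMu4P_phase dVec C P
  rw [phaseImage_eq_of_deltaClosed C hG.2.2.1 hG.2.2.2, MCell.phase_dVec] at e
  exact e.2 h

theorem ruleDMu4P_orbit (C : MConfig) (hG : G1C C) (R : MCell) (h : RuleDMu4P C R) (τ : Equiv.Perm (Fin 4)) :
    ∀ j, RuleDMu4P C (deltaIter j (R.perm τ))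
  | 0 => ruleDMu4P_perm_of C hG τ R h
  | j + 1 => ruleDMu4P_delta_of C hG _ (ruleDMu4P_orbit C hG R h τ j)

/-! ### the X family, head-wise -/

theorem dVec_apply (σ : Fin 4) : dVec σ = 1 := by revert σ; decide

theorem dsh_one_three (u : Fin 4) : dsh 1 (dsh 3 u) = u := by revert u; decide

/-- the X family holds AT THE HEAD `Z` (all partners, siblings, indices). -/
abbrev XHead (D : MConfig) (Z : MCell) : Prop := ∀ q ∈ D.upper, ∀ n ∈ D.lower, ∀ σ u w f : Fin 4, ¬ XresXFires D Z q n σ u w f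

/-- GUARDED form of the head predicate (what the kernel decides): quantifiers reordered so that each factor `σ` costs ONE scan of the partner level
(agreement off `σ` first, then the direction) and each partner ONE scan of the sibling level; apex factors pruned first. Same content as `XHead`. -/
abbrev XHeadG (D : MConfig) (Z : MCell) : Prop :=
  ∀ σ : Fin 4, ¬ isApex (Z σ) → ∀ q ∈ D.upper, MAgree q Z σ → ∀ u : Fin 4, UPartner Z q σ u →
    ∀ n ∈ D.lower, MAgree n q σ → ∀ w : Fin 4, Sibling q n σ w → ∀ f : Fin 4, ¬ XresXFires D Z q n σ u w f

theorem xHead_of_guarded {D : MConfig} {Z : MCell} (h : XHeadG D Z) : XHead D Z :=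
  fun q hq n hn σ u w f hF => h σ hF.1 q hq hF.2.2.1.1 u hF.2.2.1 n hn hF.2.2.2.2.2.1.1 w hF.2.2.2.2.2.1 f hF

theorem xresXClosed_of_heads {D : MConfig} (h : ∀ Z ∈ D.lower, XHead D Z) : XresXClosed D :=
  fun Z hZ q hq n hn σ u w f => h Z hZ q hq n hn σ u w f

theorem xHead_perm_of (D : MConfig) (hG : G1C D) (τ : Equiv.Perm (Fin 4)) (Z : MCell) (h : XHead D Z) : XHead D (Z.perm τ) := by
  intro q hq n hn σ u w f hF
  have hq' : q.perm τ⁻¹ ∈ D.upper := hG.2.1 _ q hq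
  have hn' : n.perm τ⁻¹ ∈ D.lower := hG.1 _ n hn
  have e := xresXFires_perm τ D Z (q.perm τ⁻¹) (n.perm τ⁻¹) σ u w f
  rw [permImage_eq_of_permClosed D hG.1 hG.2.1, MCell.perm_inv_perm, MCell.perm_inv_perm] at e
  exact h _ hq' _ hn' _ _ _ _ (e.1 hF)

theorem xHead_delta_of (D : MConfig) (hG : G1C D) (Z : MCell) (h : XHead D Z) : XHead D Z.delta := by
  intro q hq n hn σ u w f hF
  have hq' : q.delta.delta.delta ∈ D.upper := (DeltaClosed.iter hG.2.2.2 _ (hG.2.2.2 q hq)).1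
  have hn' : n.delta.delta.delta ∈ D.lower := (DeltaClosed.iter hG.2.2.1 _ (hG.2.2.1 n hn)).1
  obtain ⟨u', rfl⟩ : ∃ u', u = dsh (dVec σ) u' := ⟨dsh 3 u, by rw [dVec_apply, dsh_one_three]⟩
  obtain ⟨w', rfl⟩ : ∃ w', w = dsh (dVec σ) w' := ⟨dsh 3 w, by rw [dVec_apply, dsh_one_three]⟩
  have e := xresXFires_phase dVec D Z q.delta.delta.delta n.delta.delta.delta σ u' w' f
  rw [phaseImage_eq_of_deltaClosed D hG.2.2.1 hG.2.2.2, MCell.phase_dVec, MCell.phase_dVec, MCell.phase_dVec,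
    MCell.delta_four, MCell.delta_four] at e
  exact h _ hq' _ hn' _ _ _ _ (e.1 hF)

theorem xHead_orbit (D : MConfig) (hG : G1C D) (R : MCell) (h : XHead D R) (τ : Equiv.Perm (Fin 4)) :
    ∀ j, XHead D (deltaIter j (R.perm τ))
  | 0 => xHead_perm_of D hG τ R h
  | j + 1 => xHead_delta_of D hG _ (xHead_orbit D hG R h τ j)

/-! ### the A2I family, head-wise -/

/-- the A2I family holds AT THE HEAD `Z`. -/
abbrev AHead (D : MConfig) (Z : MCell) : Prop := ∀ q ∈ D.upper, ∀ N' ∈ D.lower, ∀ σ u f' v : Fin 4, ¬ XresA2IFires D Z q N' σ u f' v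

/-- GUARDED form (what the kernel decides): apex factors pruned, agreement off `σ` before the direction, the server level scanned ONCE per partner with
agreement off `f'` before the direction `v`. Same content as `AHead`. -/
abbrev AHeadG (D : MConfig) (Z : MCell) : Prop :=
  ∀ σ : Fin 4, ¬ isApex (Z σ) → ∀ q ∈ D.upper, MAgree q Z σ → ∀ u : Fin 4, EncDir (Z σ) u → UPartner Z q σ u →
    ∀ N' ∈ D.lower, ∀ f' : Fin 4, f' ≠ σ → MAgree q N' f' → ∀ v : Fin 4, UPartner N' q f' v → ¬ XresA2IFires D Z q N' σ u f' v

theorem aHead_of_guarded {D : MConfig} {Z : MCell} (h : AHeadG D Z) : AHead D Z :=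
  fun q hq N' hN σ u f' v hF =>
    h σ hF.1 q hq hF.2.2.1.1 u hF.2.1 hF.2.2.1 N' hN f' hF.2.2.2.2.1 hF.2.2.2.2.2.1.1 v hF.2.2.2.2.2.1 hF

theorem xresA2IClosed_of_heads {D : MConfig} (h : ∀ Z ∈ D.lower, AHead D Z) : XresA2IClosed D :=
  fun Z hZ q hq N' hN σ u f' v => h Z hZ q hq N' hN σ u f' v

theorem aHead_perm_of (D : MConfig) (hG : G1C D) (τ : Equiv.Perm (Fin 4)) (Z : MCell) (h : AHead D Z) : AHead D (Z.perm τ) := by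
  intro q hq N' hN σ u f' v hF
  have hq' : q.perm τ⁻¹ ∈ D.upper := hG.2.1 _ q hq
  have hN'' : N'.perm τ⁻¹ ∈ D.lower := hG.1 _ N' hN
  have e := xresA2IFires_perm τ D Z (q.perm τ⁻¹) (N'.perm τ⁻¹) σ u f' v
  rw [permImage_eq_of_permClosed D hG.1 hG.2.1, MCell.perm_inv_perm, MCell.perm_inv_perm] at e
  exact h _ hq' _ hN'' _ _ _ _ (e.1 hF)

theorem aHead_delta_of (D : MConfig) (hG : G1C D) (Z : MCell) (h : AHead D Z) : AHead D Z.delta := by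
  intro q hq N' hN σ u f' v hF
  have hq' : q.delta.delta.delta ∈ D.upper := (DeltaClosed.iter hG.2.2.2 _ (hG.2.2.2 q hq)).1
  have hN'' : N'.delta.delta.delta ∈ D.lower := (DeltaClosed.iter hG.2.2.1 _ (hG.2.2.1 N' hN)).1
  obtain ⟨u', rfl⟩ : ∃ u', u = dsh (dVec σ) u' := ⟨dsh 3 u, by rw [dVec_apply, dsh_one_three]⟩
  obtain ⟨v', rfl⟩ : ∃ v', v = dsh (dVec f') v' := ⟨dsh 3 v, by rw [dVec_apply, dsh_one_three]⟩
  have e := xresA2IFires_phase dVec D Z q.delta.delta.delta N'.delta.delta.delta σ u' f' v'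
  rw [phaseImage_eq_of_deltaClosed D hG.2.2.1 hG.2.2.2, MCell.phase_dVec, MCell.phase_dVec, MCell.phase_dVec,
    MCell.delta_four, MCell.delta_four] at e
  exact h _ hq' _ hN'' _ _ _ _ (e.1 hF)

theorem aHead_orbit (D : MConfig) (hG : G1C D) (R : MCell) (h : AHead D R) (τ : Equiv.Perm (Fin 4)) :
    ∀ j, AHead D (deltaIter j (R.perm τ))
  | 0 => aHead_perm_of D hG τ R h
  | j + 1 => aHead_delta_of D hG _ (aHead_orbit D hG R h τ j)

/-! ### the dual world commutes with the action -/

theorem dualCell_deltaIter_perm (R : MCell) (τ : Equiv.Perm (Fin 4)) : ∀ j, dualCell 0 (deltaIter j (R.perm τ)) = deltaIter j ((dualCell 0 R).perm τ)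
  | 0 => rfl
  | j + 1 => by
    show dualCell 0 (deltaIter j (R.perm τ)).delta = (deltaIter j ((dualCell 0 R).perm τ)).delta
    rw [← dualCell_deltaIter_perm R τ j, ← MCell.phase_dVec, ← MCell.phase_dVec, dualCell_phase]

theorem permClosed_image_dual {S : Finset MCell} (h : PermClosed S) : PermClosed (S.image (dualCell 0)) := by
  intro σ Z hZ
  obtain ⟨W, hW, rfl⟩ := Finset.mem_image.1 hZ
  exact Finset.mem_image.2 ⟨W.perm σ, h σ W hW, rfl⟩

theorem deltaClosed_image_dual {S : Finset MCell} (h : DeltaClosed S) : DeltaClosed (S.image (dualCell 0)) := by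
  intro Z hZ
  obtain ⟨W, hW, rfl⟩ := Finset.mem_image.1 hZ
  refine Finset.mem_image.2 ⟨W.delta, h W hW, ?_⟩
  rw [← MCell.phase_dVec, ← MCell.phase_dVec, dualCell_phase]

theorem g1C_dual {C : MConfig} (hG : G1C C) : G1C (C.dual 0) :=
  ⟨permClosed_image_dual hG.2.1, permClosed_image_dual hG.1, deltaClosed_image_dual hG.2.2.2, deltaClosed_image_dual hG.2.2.1⟩

/-! ## §8 Static families from orbit representatives (assembly) -/

/-- shape of a generated entry: an orbit image of a representative (with its multiplicity), or the all-zero junk entry. -/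
theorem genCell_shape (reps : List (MCell × ℤ)) (c : ℕ) :
    (∃ Rm ∈ reps, ∃ σ : Equiv.Perm (Fin 4), (genCell reps c).1 = deltaIter (c % 4) (Rm.1.perm σ) ∧ (genCell reps c).2 = Rm.2) ∨
      (genCell reps c).2 = 0 := by
  unfold genCell
  cases h1 : reps[c / 96]? with
  | none => right; rfl
  | some Rm =>
    cases h2 : permList[c % 96 / 4]? with
    | none => right; rfl
    | some σ =>
      left
      obtain ⟨R, m⟩ := Rm
      exact ⟨(R, m), List.mem_of_getElem? h1, σ, rfl, rfl⟩

/-- ORBIT COVER: every generated entry with non-zero multiplicity is `Δ^j (R ∘ σ)` for a representative `R`. -/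
theorem genList_cover (reps : List (MCell × ℤ)) (cs : List ℕ) (p : MCell × ℤ) (hp : p ∈ genList reps cs) (hm : p.2 ≠ 0) :
    ∃ Rm ∈ reps, ∃ σ : Equiv.Perm (Fin 4), ∃ j : ℕ, p.1 = deltaIter j (Rm.1.perm σ) := by
  rw [genList_eq] at hp
  obtain ⟨c, -, rfl⟩ := List.mem_map.1 hp
  rcases genCell_shape reps c with ⟨Rm, hR, σ, h1, -⟩ | h0
  · exact ⟨Rm, hR, σ, c % 4, h1⟩
  · exact absurd h0 hm

/-- the dual-world entry of an entry. -/
def dualE (p : MCell × ℤ) : MCell × ℤ := (dualCell 0 p.1, p.2)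

theorem map_dualE_fst (L : List (MCell × ℤ)) : (L.map dualE).map Prod.fst = (L.map Prod.fst).map (dualCell 0) := by
  simp only [List.map_map]; rfl

theorem nodup_dualE {L : List (MCell × ℤ)} (hL : (L.map Prod.fst).Nodup) : ((L.map dualE).map Prod.fst).Nodup := by
  rw [map_dualE_fst]; exact hL.map (dualCell_injective 0)

/-- the image of a level under the dual map is the level of the dual entries (no re-deduplication). -/
theorem image_levelOf_dual (L : List (MCell × ℤ)) (hL : (L.map Prod.fst).Nodup) :
    (levelOf L hL).image (dualCell 0) = levelOf (L.map dualE) (nodup_dualE hL) := by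
  apply Finset.val_inj.mp
  have hnd : (Multiset.map (dualCell 0) (↑(L.map Prod.fst) : Multiset MCell)).Nodup := by
    rw [Multiset.map_coe, Multiset.coe_nodup]; exact hL.map (dualCell_injective 0)
  simp only [Finset.image_val, levelOf]
  rw [Multiset.dedup_eq_self.2 hnd, Multiset.map_coe, map_dualE_fst]

namespace DesignCert

variable {LN LP : List (MCell × ℤ)} {tN tP : CT}

/-- the LITERAL dual-0 world of the certified design: levels `dual(P)`, `dual(N)` as mapped lists. -/
def cfgd (h : DesignCert LN LP tN tP) : MConfig := cfgOf (LP.map dualE) (LN.map dualE) (nodup_dualE h.nodupP) (nodup_dualE h.nodupN)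

/-- the dual-0 world of the design IS the literal one. -/
theorem dual_eq (h : DesignCert LN LP tN tP) : h.cfg.dual 0 = h.cfgd := by
  show MConfig.mk _ _ = MConfig.mk _ _
  rw [cfg_upper, cfg_lower, image_levelOf_dual, image_levelOf_dual]

theorem g1c (h : DesignCert LN LP tN tP) : G1C h.cfg := h.g1

theorem g1c_dual (h : DesignCert LN LP tN tP) : G1C h.cfgd := by rw [← h.dual_eq]; exact g1C_dual h.g1

/-- every `N`-cell is an orbit image of an `N`-representative (when the `N`-list is generated from `repsN`). -/
theorem coverN (h : DesignCert LN LP tN tP) {repsN : List (MCell × ℤ)} {csN : List ℕ} (hLN : LN = genList repsN csN)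
    {Z : MCell} (hZ : Z ∈ h.cfg.lower) : ∃ Rm ∈ repsN, ∃ σ : Equiv.Perm (Fin 4), ∃ j : ℕ, Z = deltaIter j (Rm.1.perm σ) := by
  obtain ⟨p, hp, rfl⟩ := List.mem_map.1 (h.mem_lower.1 hZ)
  have hm : p.2 ≠ 0 := (h.certN.pos p hp).ne'
  rw [hLN] at hp
  exact genList_cover repsN csN p hp hm

/-- every `P`-cell is an orbit image of a `P`-representative. -/
theorem coverP (h : DesignCert LN LP tN tP) {repsP : List (MCell × ℤ)} {csP : List ℕ} (hLP : LP = genList repsP csP)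
    {P : MCell} (hP : P ∈ h.cfg.upper) : ∃ Rm ∈ repsP, ∃ σ : Equiv.Perm (Fin 4), ∃ j : ℕ, P = deltaIter j (Rm.1.perm σ) := by
  obtain ⟨p, hp, rfl⟩ := List.mem_map.1 (h.mem_upper.1 hP)
  have hm : p.2 ≠ 0 := (h.certP.pos p hp).ne'
  rw [hLP] at hp
  exact genList_cover repsP csP p hp hm

theorem mem_cfgd_lower (h : DesignCert LN LP tN tP) {Z : MCell} : Z ∈ h.cfgd.lower ↔ ∃ P ∈ h.cfg.upper, Z = dualCell 0 P := by
  show Z ∈ (LP.map dualE).map Prod.fst ↔ _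
  rw [map_dualE_fst, List.mem_map]
  exact ⟨fun ⟨P, hP, e⟩ => ⟨P, h.mem_upper.2 hP, e.symm⟩, fun ⟨P, hP, e⟩ => ⟨P, h.mem_upper.1 hP, e.symm⟩⟩

/-- **RULE D (μ₄, M) CLOSED from the representatives.** -/
theorem ruleDMu4Closed_of_reps (h : DesignCert LN LP tN tP) {repsN repsP : List (MCell × ℤ)} {csN csP : List ℕ}
    (hLN : LN = genList repsN csN) (hLP : LP = genList repsP csP)
    (hN : ∀ R ∈ repsN, RuleDMu4N h.cfg R.1) (hP : ∀ R ∈ repsP, RuleDMu4P h.cfg R.1) : RuleDMu4Closed h.cfg := by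
  refine ⟨fun Z hZ => ?_, fun P hP' => ?_⟩
  · obtain ⟨Rm, hR, σ, j, rfl⟩ := h.coverN hLN hZ
    exact ruleDMu4N_orbit h.cfg h.g1c Rm.1 (hN Rm hR) σ j
  · obtain ⟨Rm, hR, σ, j, rfl⟩ := h.coverP hLP hP'
    exact ruleDMu4P_orbit h.cfg h.g1c Rm.1 (hP Rm hR) σ j

/-- RULE D at EVERY `N`-cell from the `N`-representatives (one level). -/
theorem ruleDN_of_reps (h : DesignCert LN LP tN tP) {repsN : List (MCell × ℤ)} {csN : List ℕ} (hLN : LN = genList repsN csN)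
    (hN : ∀ R ∈ repsN, RuleDMu4N h.cfg R.1) : ∀ Z ∈ h.cfg.lower, RuleDMu4N h.cfg Z := fun Z hZ => by
  obtain ⟨Rm, hR, σ, j, rfl⟩ := h.coverN hLN hZ
  exact ruleDMu4N_orbit h.cfg h.g1c Rm.1 (hN Rm hR) σ j

/-- RULE D at EVERY `P`-cell from the `P`-representatives (one level). -/
theorem ruleDP_of_reps (h : DesignCert LN LP tN tP) {repsP : List (MCell × ℤ)} {csP : List ℕ} (hLP : LP = genList repsP csP)
    (hP : ∀ R ∈ repsP, RuleDMu4P h.cfg R.1) : ∀ P ∈ h.cfg.upper, RuleDMu4P h.cfg P := fun P hP' => by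
  obtain ⟨Rm, hR, σ, j, rfl⟩ := h.coverP hLP hP'
  exact ruleDMu4P_orbit h.cfg h.g1c Rm.1 (hP Rm hR) σ j

/-- **X⁺ CLOSED from the guarded X-heads at the duals of the `P`-representatives (in the literal dual world).** -/
theorem xPlusClosed_of_reps (h : DesignCert LN LP tN tP) {repsP : List (MCell × ℤ)} {csP : List ℕ} (hLP : LP = genList repsP csP)
    (hX : ∀ R ∈ repsP, XHeadG h.cfgd (dualCell 0 R.1)) : XPlusClosed h.cfg := by
  show XresXClosed (h.cfg.dual 0)
  rw [h.dual_eq]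
  refine xresXClosed_of_heads fun Z hZ => ?_
  obtain ⟨P, hP, rfl⟩ := h.mem_cfgd_lower.1 hZ
  obtain ⟨Rm, hR, σ, j, rfl⟩ := h.coverP hLP hP
  rw [dualCell_deltaIter_perm]
  exact xHead_orbit h.cfgd h.g1c_dual _ (xHead_of_guarded (hX Rm hR)) σ j

/-- **X⁻ CLOSED from the guarded X-heads at the `N`-representatives.** -/
theorem xMinusClosed_of_reps (h : DesignCert LN LP tN tP) {repsN : List (MCell × ℤ)} {csN : List ℕ} (hLN : LN = genList repsN csN)
    (hX : ∀ R ∈ repsN, XHeadG h.cfg R.1) : XMinusClosed h.cfg := by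
  refine xresXClosed_of_heads fun Z hZ => ?_
  obtain ⟨Rm, hR, σ, j, rfl⟩ := h.coverN hLN hZ
  exact xHead_orbit h.cfg h.g1c _ (xHead_of_guarded (hX Rm hR)) σ j

/-- **A2I⁻ CLOSED from the guarded A2I-heads at the `N`-representatives.** -/
theorem a2iMinusClosed_of_reps (h : DesignCert LN LP tN tP) {repsN : List (MCell × ℤ)} {csN : List ℕ} (hLN : LN = genList repsN csN)
    (hA : ∀ R ∈ repsN, AHeadG h.cfg R.1) : A2IMinusClosed h.cfg := by
  refine xresA2IClosed_of_heads fun Z hZ => ?_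
  obtain ⟨Rm, hR, σ, j, rfl⟩ := h.coverN hLN hZ
  exact aHead_orbit h.cfg h.g1c _ (aHead_of_guarded (hA Rm hR)) σ j

/-- **A2I⁺ CLOSED from the guarded A2I-heads at the duals of the `P`-representatives.** -/
theorem a2iPlusClosed_of_reps (h : DesignCert LN LP tN tP) {repsP : List (MCell × ℤ)} {csP : List ℕ} (hLP : LP = genList repsP csP)
    (hA : ∀ R ∈ repsP, AHeadG h.cfgd (dualCell 0 R.1)) : A2IPlusClosed h.cfg := by
  show XresA2IClosed (h.cfg.dual 0)
  rw [h.dual_eq]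
  refine xresA2IClosed_of_heads fun Z hZ => ?_
  obtain ⟨P, hP, rfl⟩ := h.mem_cfgd_lower.1 hZ
  obtain ⟨Rm, hR, σ, j, rfl⟩ := h.coverP hLP hP
  rw [dualCell_deltaIter_perm]
  exact aHead_orbit h.cfgd h.g1c_dual _ (aHead_of_guarded (hA Rm hR)) σ j

end DesignCert

/-! ## §9 One-pass evaluators for the 22 + 1 representative words (all words in one sweep over the cells; CSE'd integer straight-line code) -/

/-- negate the multiplicities (the `P`-level enters the class tensor with a minus sign). -/
def negM (L : List (MCell × ℤ)) : List (MCell × ℤ) := L.map fun p => (p.1, -p.2)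

/-- the real part of a word's list sum, as an integer list sum over the raw cell values. -/
def reSum (w : CWord) (L : List (MCell × ℤ)) : ℤ := (L.map fun p => p.2 * (chRaw p.1 w).1).sum
/-- the imaginary part of a word's list sum, as an integer list sum over the raw cell values. -/
def imSum (w : CWord) (L : List (MCell × ℤ)) : ℤ := (L.map fun p => p.2 * (chRaw p.1 w).2).sum

theorem re_listSum (w : CWord) (L : List (MCell × ℤ)) : (listSum w L).re = reSum w L := by
  induction L with
  | nil => simp [listSum, reSum]
  | cons p L ih =>
    simp only [listSum, reSum, List.map_cons, List.sum_cons, Zsqrtd.re_add, Zsqrtd.re_smul] at ih ⊢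
    rw [ih, ← toG_chRaw]; rfl

theorem im_listSum (w : CWord) (L : List (MCell × ℤ)) : (listSum w L).im = imSum w L := by
  induction L with
  | nil => simp [listSum, imSum]
  | cons p L ih =>
    simp only [listSum, imSum, List.map_cons, List.sum_cons, Zsqrtd.im_add, Zsqrtd.im_smul] at ih ⊢
    rw [ih, ← toG_chRaw]; rfl

theorem reSum_append (w : CWord) (L₁ L₂ : List (MCell × ℤ)) : reSum w (L₁ ++ L₂) = reSum w L₁ + reSum w L₂ := by
  simp [reSum, List.map_append, List.sum_append]

theorem imSum_append (w : CWord) (L₁ L₂ : List (MCell × ℤ)) : imSum w (L₁ ++ L₂) = imSum w L₁ + imSum w L₂ := by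
  simp [imSum, List.map_append, List.sum_append]

theorem reSum_negM (w : CWord) (L : List (MCell × ℤ)) : reSum w (negM L) = -reSum w L := by
  induction L with
  | nil => simp [reSum, negM]
  | cons p L ih =>
    simp only [reSum, negM, List.map_cons, List.sum_cons] at ih ⊢
    rw [ih]; ring

theorem imSum_negM (w : CWord) (L : List (MCell × ℤ)) : imSum w (negM L) = -imSum w L := by
  induction L with
  | nil => simp [imSum, negM]
  | cons p L ih =>
    simp only [imSum, negM, List.map_cons, List.sum_cons] at ih ⊢
    rw [ih]; ring

theorem reSum_append_negM (w : CWord) (LN LP : List (MCell × ℤ)) : reSum w (LN ++ negM LP) = reSum w LN - reSum w LP := by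
  rw [reSum_append, reSum_negM, sub_eq_add_neg]

theorem imSum_append_negM (w : CWord) (LN LP : List (MCell × ℤ)) : imSum w (LN ++ negM LP) = imSum w LN - imSum w LP := by
  rw [imSum_append, imSum_negM, sub_eq_add_neg]

/-- the difference of the list sums, componentwise, from the one-pass sums over `LN ++ negM LP`. -/
theorem listSum_sub_eq (w : CWord) (LN LP : List (MCell × ℤ)) (a b : ℤ) (ha : reSum w (LN ++ negM LP) = a)
    (hb : imSum w (LN ++ negM LP) = b) : listSum w LN - listSum w LP = ⟨a, b⟩ := by
  ext
  · rw [Zsqrtd.re_sub, re_listSum, re_listSum, ← reSum_append_negM, ha]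
  · rw [Zsqrtd.im_sub, im_listSum, im_listSum, ← imSum_append_negM, hb]

/-! ### group A: the 15 e-free representatives (real; products of `α_f` and `p_f = α_f² − |β_f|²`) -/

section PolyA
variable (Z : MCell)
theorem chA_1 : chRaw Z ![0, 0, 0, 0] = (1, 0) := by
  ext <;> simp [chRaw, gmul, letv, -mul_eq_mul_left_iff, -mul_eq_mul_right_iff]
theorem chA_2 : chRaw Z ![1, 0, 0, 0] = ((Z 0).1, 0) := by
  ext <;> simp [chRaw, gmul, letv, -mul_eq_mul_left_iff, -mul_eq_mul_right_iff]
theorem chA_3 : chRaw Z ![1, 1, 0, 0] = ((Z 0).1 * (Z 1).1, 0) := by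
  ext <;> simp [chRaw, gmul, letv, -mul_eq_mul_left_iff, -mul_eq_mul_right_iff]
theorem chA_4 : chRaw Z ![1, 1, 1, 0] = ((Z 0).1 * (Z 1).1 * (Z 2).1, 0) := by
  ext <;> simp [chRaw, gmul, letv, -mul_eq_mul_left_iff, -mul_eq_mul_right_iff]
theorem chA_5 : chRaw Z ![1, 1, 1, 1] = ((Z 0).1 * (Z 1).1 * (Z 2).1 * (Z 3).1, 0) := by
  ext <;> simp [chRaw, gmul, letv, -mul_eq_mul_left_iff, -mul_eq_mul_right_iff]
theorem chA_6 : chRaw Z ![5, 0, 0, 0] = ((Z 0).1 * (Z 0).1 - (Z 0).2.1 * (Z 0).2.1 - (Z 0).2.2 * (Z 0).2.2, 0) := by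
  ext <;> simp [chRaw, gmul, letv, -mul_eq_mul_left_iff, -mul_eq_mul_right_iff]
theorem chA_7 : chRaw Z ![5, 1, 0, 0] = (((Z 0).1 * (Z 0).1 - (Z 0).2.1 * (Z 0).2.1 - (Z 0).2.2 * (Z 0).2.2) * (Z 1).1, 0) := by
  ext <;> simp [chRaw, gmul, letv, -mul_eq_mul_left_iff, -mul_eq_mul_right_iff]
theorem chA_8 : chRaw Z ![5, 1, 1, 0] = (((Z 0).1 * (Z 0).1 - (Z 0).2.1 * (Z 0).2.1 - (Z 0).2.2 * (Z 0).2.2) * (Z 1).1 * (Z 2).1, 0) := by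
  ext <;> simp [chRaw, gmul, letv, -mul_eq_mul_left_iff, -mul_eq_mul_right_iff]
theorem chA_9 : chRaw Z ![5, 1, 1, 1] =
    (((Z 0).1 * (Z 0).1 - (Z 0).2.1 * (Z 0).2.1 - (Z 0).2.2 * (Z 0).2.2) * (Z 1).1 * (Z 2).1 * (Z 3).1, 0) := by
  ext <;> simp [chRaw, gmul, letv, -mul_eq_mul_left_iff, -mul_eq_mul_right_iff]
theorem chA_10 : chRaw Z ![5, 5, 0, 0] = (((Z 0).1 * (Z 0).1 - (Z 0).2.1 * (Z 0).2.1 - (Z 0).2.2 * (Z 0).2.2) *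
    ((Z 1).1 * (Z 1).1 - (Z 1).2.1 * (Z 1).2.1 - (Z 1).2.2 * (Z 1).2.2), 0) := by
  ext <;> simp [chRaw, gmul, letv, -mul_eq_mul_left_iff, -mul_eq_mul_right_iff]
theorem chA_11 : chRaw Z ![5, 5, 1, 0] = (((Z 0).1 * (Z 0).1 - (Z 0).2.1 * (Z 0).2.1 - (Z 0).2.2 * (Z 0).2.2) *
    ((Z 1).1 * (Z 1).1 - (Z 1).2.1 * (Z 1).2.1 - (Z 1).2.2 * (Z 1).2.2) * (Z 2).1, 0) := by
  ext <;> simp [chRaw, gmul, letv, -mul_eq_mul_left_iff, -mul_eq_mul_right_iff]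
theorem chA_12 : chRaw Z ![5, 5, 1, 1] = (((Z 0).1 * (Z 0).1 - (Z 0).2.1 * (Z 0).2.1 - (Z 0).2.2 * (Z 0).2.2) *
    ((Z 1).1 * (Z 1).1 - (Z 1).2.1 * (Z 1).2.1 - (Z 1).2.2 * (Z 1).2.2) * (Z 2).1 * (Z 3).1, 0) := by
  ext <;> simp [chRaw, gmul, letv, -mul_eq_mul_left_iff, -mul_eq_mul_right_iff]
theorem chA_13 : chRaw Z ![5, 5, 5, 0] = (((Z 0).1 * (Z 0).1 - (Z 0).2.1 * (Z 0).2.1 - (Z 0).2.2 * (Z 0).2.2) *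
    ((Z 1).1 * (Z 1).1 - (Z 1).2.1 * (Z 1).2.1 - (Z 1).2.2 * (Z 1).2.2) *
    ((Z 2).1 * (Z 2).1 - (Z 2).2.1 * (Z 2).2.1 - (Z 2).2.2 * (Z 2).2.2), 0) := by
  ext <;> simp [chRaw, gmul, letv, -mul_eq_mul_left_iff, -mul_eq_mul_right_iff]
theorem chA_14 : chRaw Z ![5, 5, 5, 1] = (((Z 0).1 * (Z 0).1 - (Z 0).2.1 * (Z 0).2.1 - (Z 0).2.2 * (Z 0).2.2) *
    ((Z 1).1 * (Z 1).1 - (Z 1).2.1 * (Z 1).2.1 - (Z 1).2.2 * (Z 1).2.2) *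
    ((Z 2).1 * (Z 2).1 - (Z 2).2.1 * (Z 2).2.1 - (Z 2).2.2 * (Z 2).2.2) * (Z 3).1, 0) := by
  ext <;> simp [chRaw, gmul, letv, -mul_eq_mul_left_iff, -mul_eq_mul_right_iff]
theorem chA_15 : chRaw Z ![5, 5, 5, 5] = (((Z 0).1 * (Z 0).1 - (Z 0).2.1 * (Z 0).2.1 - (Z 0).2.2 * (Z 0).2.2) *
    ((Z 1).1 * (Z 1).1 - (Z 1).2.1 * (Z 1).2.1 - (Z 1).2.2 * (Z 1).2.2) *
    ((Z 2).1 * (Z 2).1 - (Z 2).2.1 * (Z 2).2.1 - (Z 2).2.2 * (Z 2).2.2) *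
    ((Z 3).1 * (Z 3).1 - (Z 3).2.1 * (Z 3).2.1 - (Z 3).2.2 * (Z 3).2.2), 0) := by
  ext <;> simp [chRaw, gmul, letv, -mul_eq_mul_left_iff, -mul_eq_mul_right_iff]
end PolyA

/-- the 15 e-free representative values of ONE cell (in the order of `freeReps`), computed with shared sub-products, every
intermediate forced, passed on to `k`. -/
def monoA {α : Type} (Z : MCell) (k : ℤ → ℤ → ℤ → ℤ → ℤ → ℤ → ℤ → ℤ → ℤ → ℤ → ℤ → ℤ → ℤ → ℤ → ℤ → α) : α :=
  forceInt (Z 0).1 fun a0 => forceInt (Z 0).2.1 fun r0 => forceInt (Z 0).2.2 fun i0 =>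
  forceInt (Z 1).1 fun a1 => forceInt (Z 1).2.1 fun r1 => forceInt (Z 1).2.2 fun i1 =>
  forceInt (Z 2).1 fun a2 => forceInt (Z 2).2.1 fun r2 => forceInt (Z 2).2.2 fun i2 =>
  forceInt (Z 3).1 fun a3 => forceInt (Z 3).2.1 fun r3 => forceInt (Z 3).2.2 fun i3 =>
  forceInt (a0 * a0 - r0 * r0 - i0 * i0) fun p0 => forceInt (a1 * a1 - r1 * r1 - i1 * i1) fun p1 =>
  forceInt (a2 * a2 - r2 * r2 - i2 * i2) fun p2 => forceInt (a3 * a3 - r3 * r3 - i3 * i3) fun p3 =>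
  forceInt (a0 * a1) fun t1 => forceInt (t1 * a2) fun t2 => forceInt (t2 * a3) fun t3 =>
  forceInt (p0 * a1) fun t4 => forceInt (t4 * a2) fun t5 => forceInt (t5 * a3) fun t6 =>
  forceInt (p0 * p1) fun t7 => forceInt (t7 * a2) fun t8 => forceInt (t8 * a3) fun t9 =>
  forceInt (t7 * p2) fun t10 => forceInt (t10 * a3) fun t11 => forceInt (t10 * p3) fun t12 =>
  k 1 a0 t1 t2 t3 p0 t4 t5 t6 t7 t8 t9 t10 t11 t12

/-- `monoA` computes the real parts of the raw cell values at the 15 free representatives. -/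
theorem monoA_eq {α : Type} (Z : MCell) (k : ℤ → ℤ → ℤ → ℤ → ℤ → ℤ → ℤ → ℤ → ℤ → ℤ → ℤ → ℤ → ℤ → ℤ → ℤ → α) :
    monoA Z k = k (chRaw Z ![0, 0, 0, 0]).1 (chRaw Z ![1, 0, 0, 0]).1 (chRaw Z ![1, 1, 0, 0]).1 (chRaw Z ![1, 1, 1, 0]).1
      (chRaw Z ![1, 1, 1, 1]).1 (chRaw Z ![5, 0, 0, 0]).1 (chRaw Z ![5, 1, 0, 0]).1 (chRaw Z ![5, 1, 1, 0]).1 (chRaw Z ![5, 1, 1, 1]).1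
      (chRaw Z ![5, 5, 0, 0]).1 (chRaw Z ![5, 5, 1, 0]).1 (chRaw Z ![5, 5, 1, 1]).1 (chRaw Z ![5, 5, 5, 0]).1 (chRaw Z ![5, 5, 5, 1]).1
      (chRaw Z ![5, 5, 5, 5]).1 := by
  simp only [monoA, forceInt_eq, chA_1, chA_2, chA_3, chA_4, chA_5, chA_6, chA_7, chA_8, chA_9, chA_10, chA_11, chA_12, chA_13,
    chA_14, chA_15]

/-- ONE-PASS accumulator of the 15 free representative sums. -/
def sumA : List (MCell × ℤ) → ℤ → ℤ → ℤ → ℤ → ℤ → ℤ → ℤ → ℤ → ℤ → ℤ → ℤ → ℤ → ℤ → ℤ → ℤ → List ℤ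
  | [], s1, s2, s3, s4, s5, s6, s7, s8, s9, s10, s11, s12, s13, s14, s15 => [s1, s2, s3, s4, s5, s6, s7, s8, s9, s10, s11, s12, s13, s14, s15]
  | (Z, m) :: L, s1, s2, s3, s4, s5, s6, s7, s8, s9, s10, s11, s12, s13, s14, s15 =>
    monoA Z fun v1 v2 v3 v4 v5 v6 v7 v8 v9 v10 v11 v12 v13 v14 v15 =>
      forceInt (s1 + m * v1) fun s1 => forceInt (s2 + m * v2) fun s2 => forceInt (s3 + m * v3) fun s3 =>
      forceInt (s4 + m * v4) fun s4 => forceInt (s5 + m * v5) fun s5 => forceInt (s6 + m * v6) fun s6 =>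
      forceInt (s7 + m * v7) fun s7 => forceInt (s8 + m * v8) fun s8 => forceInt (s9 + m * v9) fun s9 =>
      forceInt (s10 + m * v10) fun s10 => forceInt (s11 + m * v11) fun s11 => forceInt (s12 + m * v12) fun s12 =>
      forceInt (s13 + m * v13) fun s13 => forceInt (s14 + m * v14) fun s14 => forceInt (s15 + m * v15) fun s15 =>
      sumA L s1 s2 s3 s4 s5 s6 s7 s8 s9 s10 s11 s12 s13 s14 s15

/-- `sumA` accumulates the 15 real sums `reSum`. -/
theorem sumA_eq (L : List (MCell × ℤ)) (s1 s2 s3 s4 s5 s6 s7 s8 s9 s10 s11 s12 s13 s14 s15 : ℤ) :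
    sumA L s1 s2 s3 s4 s5 s6 s7 s8 s9 s10 s11 s12 s13 s14 s15 =
      [s1 + reSum ![0, 0, 0, 0] L, s2 + reSum ![1, 0, 0, 0] L, s3 + reSum ![1, 1, 0, 0] L, s4 + reSum ![1, 1, 1, 0] L,
       s5 + reSum ![1, 1, 1, 1] L, s6 + reSum ![5, 0, 0, 0] L, s7 + reSum ![5, 1, 0, 0] L, s8 + reSum ![5, 1, 1, 0] L,
       s9 + reSum ![5, 1, 1, 1] L, s10 + reSum ![5, 5, 0, 0] L, s11 + reSum ![5, 5, 1, 0] L, s12 + reSum ![5, 5, 1, 1] L,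
       s13 + reSum ![5, 5, 5, 0] L, s14 + reSum ![5, 5, 5, 1] L, s15 + reSum ![5, 5, 5, 5] L] := by
  induction L generalizing s1 s2 s3 s4 s5 s6 s7 s8 s9 s10 s11 s12 s13 s14 s15 with
  | nil => simp [sumA, reSum]
  | cons p L ih =>
    obtain ⟨Z, m⟩ := p
    simp only [sumA, monoA_eq, forceInt_eq, ih, reSum, List.map_cons, List.sum_cons, add_assoc]

/-! ### group B: the 7 mixed representatives and `eeee` (complex; shared sub-products `e₀ē₁`, `e₀e₁`, `e₂e₃`) -/

section PolyB
variable (Z : MCell)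
theorem chB_1 : chRaw Z ![3, 4, 0, 0] =
    ((Z 0).2.1 * (Z 1).2.1 + (Z 0).2.2 * (Z 1).2.2, (Z 0).2.2 * (Z 1).2.1 - (Z 0).2.1 * (Z 1).2.2) := by
  ext <;> simp [chRaw, gmul, letv, -mul_eq_mul_left_iff, -mul_eq_mul_right_iff] <;> ring
theorem chB_2 : chRaw Z ![3, 4, 0, 1] =
    (((Z 0).2.1 * (Z 1).2.1 + (Z 0).2.2 * (Z 1).2.2) * (Z 3).1, ((Z 0).2.2 * (Z 1).2.1 - (Z 0).2.1 * (Z 1).2.2) * (Z 3).1) := by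
  ext <;> simp [chRaw, gmul, letv, -mul_eq_mul_left_iff, -mul_eq_mul_right_iff] <;> ring
theorem chB_3 : chRaw Z ![3, 4, 0, 5] =
    (((Z 0).2.1 * (Z 1).2.1 + (Z 0).2.2 * (Z 1).2.2) * ((Z 3).1 * (Z 3).1 - (Z 3).2.1 * (Z 3).2.1 - (Z 3).2.2 * (Z 3).2.2),
     ((Z 0).2.2 * (Z 1).2.1 - (Z 0).2.1 * (Z 1).2.2) * ((Z 3).1 * (Z 3).1 - (Z 3).2.1 * (Z 3).2.1 - (Z 3).2.2 * (Z 3).2.2)) := by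
  ext <;> simp [chRaw, gmul, letv, -mul_eq_mul_left_iff, -mul_eq_mul_right_iff] <;> ring
theorem chB_4 : chRaw Z ![3, 4, 1, 1] =
    (((Z 0).2.1 * (Z 1).2.1 + (Z 0).2.2 * (Z 1).2.2) * ((Z 2).1 * (Z 3).1), ((Z 0).2.2 * (Z 1).2.1 - (Z 0).2.1 * (Z 1).2.2) * ((Z 2).1 * (Z 3).1)) := by
  ext <;> simp [chRaw, gmul, letv, -mul_eq_mul_left_iff, -mul_eq_mul_right_iff] <;> ring
theorem chB_5 : chRaw Z ![3, 4, 1, 5] =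
    (((Z 0).2.1 * (Z 1).2.1 + (Z 0).2.2 * (Z 1).2.2) * ((Z 2).1 * ((Z 3).1 * (Z 3).1 - (Z 3).2.1 * (Z 3).2.1 - (Z 3).2.2 * (Z 3).2.2)),
     ((Z 0).2.2 * (Z 1).2.1 - (Z 0).2.1 * (Z 1).2.2) * ((Z 2).1 * ((Z 3).1 * (Z 3).1 - (Z 3).2.1 * (Z 3).2.1 - (Z 3).2.2 * (Z 3).2.2))) := by
  ext <;> simp [chRaw, gmul, letv, -mul_eq_mul_left_iff, -mul_eq_mul_right_iff] <;> ring
theorem chB_6 : chRaw Z ![3, 4, 5, 5] =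
    (((Z 0).2.1 * (Z 1).2.1 + (Z 0).2.2 * (Z 1).2.2) *
      (((Z 2).1 * (Z 2).1 - (Z 2).2.1 * (Z 2).2.1 - (Z 2).2.2 * (Z 2).2.2) * ((Z 3).1 * (Z 3).1 - (Z 3).2.1 * (Z 3).2.1 - (Z 3).2.2 * (Z 3).2.2)),
     ((Z 0).2.2 * (Z 1).2.1 - (Z 0).2.1 * (Z 1).2.2) *
      (((Z 2).1 * (Z 2).1 - (Z 2).2.1 * (Z 2).2.1 - (Z 2).2.2 * (Z 2).2.2) * ((Z 3).1 * (Z 3).1 - (Z 3).2.1 * (Z 3).2.1 - (Z 3).2.2 * (Z 3).2.2))) := by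
  ext <;> simp [chRaw, gmul, letv, -mul_eq_mul_left_iff, -mul_eq_mul_right_iff] <;> ring
theorem chB_7 : chRaw Z ![3, 3, 4, 4] =
    (((Z 0).2.1 * (Z 1).2.1 - (Z 0).2.2 * (Z 1).2.2) * ((Z 2).2.1 * (Z 3).2.1 - (Z 2).2.2 * (Z 3).2.2) +
        ((Z 0).2.1 * (Z 1).2.2 + (Z 0).2.2 * (Z 1).2.1) * ((Z 2).2.1 * (Z 3).2.2 + (Z 2).2.2 * (Z 3).2.1),
     ((Z 0).2.1 * (Z 1).2.2 + (Z 0).2.2 * (Z 1).2.1) * ((Z 2).2.1 * (Z 3).2.1 - (Z 2).2.2 * (Z 3).2.2) -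
        ((Z 0).2.1 * (Z 1).2.1 - (Z 0).2.2 * (Z 1).2.2) * ((Z 2).2.1 * (Z 3).2.2 + (Z 2).2.2 * (Z 3).2.1)) := by
  ext <;> simp [chRaw, gmul, letv, -mul_eq_mul_left_iff, -mul_eq_mul_right_iff] <;> ring
theorem chB_8 : chRaw Z eWord =
    (((Z 0).2.1 * (Z 1).2.1 - (Z 0).2.2 * (Z 1).2.2) * ((Z 2).2.1 * (Z 3).2.1 - (Z 2).2.2 * (Z 3).2.2) -
        ((Z 0).2.1 * (Z 1).2.2 + (Z 0).2.2 * (Z 1).2.1) * ((Z 2).2.1 * (Z 3).2.2 + (Z 2).2.2 * (Z 3).2.1),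
     ((Z 0).2.1 * (Z 1).2.1 - (Z 0).2.2 * (Z 1).2.2) * ((Z 2).2.1 * (Z 3).2.2 + (Z 2).2.2 * (Z 3).2.1) +
        ((Z 0).2.1 * (Z 1).2.2 + (Z 0).2.2 * (Z 1).2.1) * ((Z 2).2.1 * (Z 3).2.1 - (Z 2).2.2 * (Z 3).2.2)) := by
  ext <;> simp [chRaw, gmul, letv, eWord, -mul_eq_mul_left_iff, -mul_eq_mul_right_iff] <;> ring
end PolyB

/-- the 8 complex representative values (7 mixed + `eeee`, as 16 integers re∕im in the order of `mixedReps`, then `eeee`) of ONE cell,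
shared sub-products, every intermediate forced, passed on to `k`. -/
def monoB {α : Type} (Z : MCell) (k : ℤ → ℤ → ℤ → ℤ → ℤ → ℤ → ℤ → ℤ → ℤ → ℤ → ℤ → ℤ → ℤ → ℤ → ℤ → ℤ → α) : α :=
  forceInt (Z 0).2.1 fun r0 => forceInt (Z 0).2.2 fun i0 => forceInt (Z 1).2.1 fun r1 => forceInt (Z 1).2.2 fun i1 =>
  forceInt (Z 2).1 fun a2 => forceInt (Z 2).2.1 fun r2 => forceInt (Z 2).2.2 fun i2 =>
  forceInt (Z 3).1 fun a3 => forceInt (Z 3).2.1 fun r3 => forceInt (Z 3).2.2 fun i3 =>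
  forceInt (a2 * a2 - r2 * r2 - i2 * i2) fun p2 => forceInt (a3 * a3 - r3 * r3 - i3 * i3) fun p3 =>
  forceInt (r0 * r1 + i0 * i1) fun bre => forceInt (i0 * r1 - r0 * i1) fun bim =>
  forceInt (a2 * a3) fun t1 => forceInt (a2 * p3) fun t2 => forceInt (p2 * p3) fun t3 =>
  forceInt (r0 * r1 - i0 * i1) fun cre => forceInt (r0 * i1 + i0 * r1) fun cim =>
  forceInt (r2 * r3 - i2 * i3) fun ere => forceInt (r2 * i3 + i2 * r3) fun eim =>
  k bre bim (bre * a3) (bim * a3) (bre * p3) (bim * p3) (bre * t1) (bim * t1) (bre * t2) (bim * t2) (bre * t3) (bim * t3)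
    (cre * ere + cim * eim) (cim * ere - cre * eim) (cre * ere - cim * eim) (cre * eim + cim * ere)

/-- `monoB` computes the raw cell values at the 7 mixed representatives and at `eeee`. -/
theorem monoB_eq {α : Type} (Z : MCell) (k : ℤ → ℤ → ℤ → ℤ → ℤ → ℤ → ℤ → ℤ → ℤ → ℤ → ℤ → ℤ → ℤ → ℤ → ℤ → ℤ → α) :
    monoB Z k = k (chRaw Z ![3, 4, 0, 0]).1 (chRaw Z ![3, 4, 0, 0]).2 (chRaw Z ![3, 4, 0, 1]).1 (chRaw Z ![3, 4, 0, 1]).2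
      (chRaw Z ![3, 4, 0, 5]).1 (chRaw Z ![3, 4, 0, 5]).2 (chRaw Z ![3, 4, 1, 1]).1 (chRaw Z ![3, 4, 1, 1]).2
      (chRaw Z ![3, 4, 1, 5]).1 (chRaw Z ![3, 4, 1, 5]).2 (chRaw Z ![3, 4, 5, 5]).1 (chRaw Z ![3, 4, 5, 5]).2
      (chRaw Z ![3, 3, 4, 4]).1 (chRaw Z ![3, 3, 4, 4]).2 (chRaw Z eWord).1 (chRaw Z eWord).2 := by
  simp only [monoB, forceInt_eq, chB_1, chB_2, chB_3, chB_4, chB_5, chB_6, chB_7, chB_8]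

/-- ONE-PASS accumulator of the 8 complex representative sums (16 integers). -/
def sumB : List (MCell × ℤ) → ℤ → ℤ → ℤ → ℤ → ℤ → ℤ → ℤ → ℤ → ℤ → ℤ → ℤ → ℤ → ℤ → ℤ → ℤ → ℤ → List ℤ
  | [], s1, s2, s3, s4, s5, s6, s7, s8, s9, s10, s11, s12, s13, s14, s15, s16 =>
    [s1, s2, s3, s4, s5, s6, s7, s8, s9, s10, s11, s12, s13, s14, s15, s16]
  | (Z, m) :: L, s1, s2, s3, s4, s5, s6, s7, s8, s9, s10, s11, s12, s13, s14, s15, s16 =>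
    monoB Z fun v1 v2 v3 v4 v5 v6 v7 v8 v9 v10 v11 v12 v13 v14 v15 v16 =>
      forceInt (s1 + m * v1) fun s1 => forceInt (s2 + m * v2) fun s2 => forceInt (s3 + m * v3) fun s3 =>
      forceInt (s4 + m * v4) fun s4 => forceInt (s5 + m * v5) fun s5 => forceInt (s6 + m * v6) fun s6 =>
      forceInt (s7 + m * v7) fun s7 => forceInt (s8 + m * v8) fun s8 => forceInt (s9 + m * v9) fun s9 =>
      forceInt (s10 + m * v10) fun s10 => forceInt (s11 + m * v11) fun s11 => forceInt (s12 + m * v12) fun s12 =>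
      forceInt (s13 + m * v13) fun s13 => forceInt (s14 + m * v14) fun s14 => forceInt (s15 + m * v15) fun s15 =>
      forceInt (s16 + m * v16) fun s16 =>
      sumB L s1 s2 s3 s4 s5 s6 s7 s8 s9 s10 s11 s12 s13 s14 s15 s16

/-- `sumB` accumulates the 8 complex sums (`reSum`∕`imSum` pairs). -/
theorem sumB_eq (L : List (MCell × ℤ)) (s1 s2 s3 s4 s5 s6 s7 s8 s9 s10 s11 s12 s13 s14 s15 s16 : ℤ) :
    sumB L s1 s2 s3 s4 s5 s6 s7 s8 s9 s10 s11 s12 s13 s14 s15 s16 =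
      [s1 + reSum ![3, 4, 0, 0] L, s2 + imSum ![3, 4, 0, 0] L, s3 + reSum ![3, 4, 0, 1] L, s4 + imSum ![3, 4, 0, 1] L,
       s5 + reSum ![3, 4, 0, 5] L, s6 + imSum ![3, 4, 0, 5] L, s7 + reSum ![3, 4, 1, 1] L, s8 + imSum ![3, 4, 1, 1] L,
       s9 + reSum ![3, 4, 1, 5] L, s10 + imSum ![3, 4, 1, 5] L, s11 + reSum ![3, 4, 5, 5] L, s12 + imSum ![3, 4, 5, 5] L,
       s13 + reSum ![3, 3, 4, 4] L, s14 + imSum ![3, 3, 4, 4] L, s15 + reSum eWord L, s16 + imSum eWord L] := by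
  induction L generalizing s1 s2 s3 s4 s5 s6 s7 s8 s9 s10 s11 s12 s13 s14 s15 s16 with
  | nil => simp [sumB, reSum, imSum]
  | cons p L ih =>
    obtain ⟨Z, m⟩ := p
    simp only [sumB, monoB_eq, forceInt_eq, ih, reSum, imSum, List.map_cons, List.sum_cons, add_assoc]

/-- e-free letters have real raw values. -/
theorem letv_im_zero (x : BPoint) (l : Fin 6) (h3 : l ≠ 3) (h4 : l ≠ 4) : (letv x l).2 = 0 := by
  fin_cases l <;> simp_all [letv]

theorem gmul_im_zero {a b : ℤ × ℤ} (ha : a.2 = 0) (hb : b.2 = 0) : (gmul a b).2 = 0 := by simp [gmul, ha, hb]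

/-- the raw value of a cell at an e-free word is real. -/
theorem chRaw_im_zero (Z : MCell) (w : CWord) (hw : EFree w) : (chRaw Z w).2 = 0 :=
  gmul_im_zero (gmul_im_zero (gmul_im_zero (letv_im_zero _ _ (hw 0).1 (hw 0).2) (letv_im_zero _ _ (hw 1).1 (hw 1).2))
    (letv_im_zero _ _ (hw 2).1 (hw 2).2)) (letv_im_zero _ _ (hw 3).1 (hw 3).2)

theorem imSum_zero (w : CWord) (hw : EFree w) (L : List (MCell × ℤ)) : imSum w L = 0 := by
  induction L with
  | nil => simp [imSum]
  | cons p L ih => simp only [imSum, List.map_cons, List.sum_cons, chRaw_im_zero _ _ hw, mul_zero, zero_add] at ih ⊢; exact ih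

namespace DesignCert

variable {LN LP : List (MCell × ℤ)} {tN tP : CT}

/-- a word value of the certified design from the one-pass integer sums. -/
theorem wch_of_sums (h : DesignCert LN LP tN tP) (w : CWord) (a b : ℤ) (ha : reSum w (LN ++ negM LP) = a)
    (hb : imSum w (LN ++ negM LP) = b) : h.cfg.wch (mT tN) (mT tP) w = ⟨a, b⟩ := by
  rw [h.wch_eq, toG_rawT]; exact listSum_sub_eq w LN LP a b ha hb

/-- a word value at an e-free word from the real one-pass sum alone. -/
theorem wch_of_reSum (h : DesignCert LN LP tN tP) (w : CWord) (hw : EFree w) (a : ℤ) (ha : reSum w (LN ++ negM LP) = a) :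
    h.cfg.wch (mT tN) (mT tP) w = ⟨a, 0⟩ := h.wch_of_sums w a 0 ha (imSum_zero w hw _)

/-- **(A1), μ and the free values of the certified design from the two one-pass evaluations.** -/
theorem classScreen_of_sums (h : DesignCert LN LP tN tP) (q : ℕ → ℤ) (x15 x16 : ℤ)
    (hA : sumA (LN ++ negM LP) 0 0 0 0 0 0 0 0 0 0 0 0 0 0 0 =
      [q 0, q 1, q 2, q 3, q 4, q 2, q 3, q 4, q 5, q 4, q 5, q 6, q 6, q 7, q 8])
    (hB : sumB (LN ++ negM LP) 0 0 0 0 0 0 0 0 0 0 0 0 0 0 0 0 = [0, 0, 0, 0, 0, 0, 0, 0, 0, 0, 0, 0, 0, 0, x15, x16]) :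
    ClassScreen (h.cfg.wch (mT tN) (mT tP)) ∧ h.cfg.wch (mT tN) (mT tP) eWord = ⟨x15, x16⟩ := by
  rw [sumA_eq] at hA
  rw [sumB_eq] at hB
  simp only [zero_add, List.cons.injEq, and_true] at hA hB
  obtain ⟨a1, a2, a3, a4, a5, a6, a7, a8, a9, a10, a11, a12, a13, a14, a15⟩ := hA
  obtain ⟨b1, b2, b3, b4, b5, b6, b7, b8, b9, b10, b11, b12, b13, b14, b15, b16⟩ := hB
  obtain ⟨g1, g2, g3, g4⟩ := h.g1
  refine ⟨classScreen_of_reps h.cfg (mT tN) (mT tP) g1 g2 g3 g4 h.certN.pInv h.certP.pInv h.certN.dInv h.certP.dInv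
    (fun k => ⟨q k, 0⟩) (fun r hr => ?_) (fun r hr => ?_), h.wch_of_sums eWord x15 x16 b15 b16⟩
  · simp only [mixedReps, List.mem_cons, List.not_mem_nil, or_false] at hr
    rcases hr with rfl | rfl | rfl | rfl | rfl | rfl | rfl
    · exact h.wch_of_sums _ 0 0 b1 b2
    · exact h.wch_of_sums _ 0 0 b3 b4
    · exact h.wch_of_sums _ 0 0 b5 b6
    · exact h.wch_of_sums _ 0 0 b7 b8
    · exact h.wch_of_sums _ 0 0 b9 b10
    · exact h.wch_of_sums _ 0 0 b11 b12
    · exact h.wch_of_sums _ 0 0 b13 b14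
  · simp only [freeReps, List.mem_cons, List.not_mem_nil, or_false] at hr
    rcases hr with rfl | rfl | rfl | rfl | rfl | rfl | rfl | rfl | rfl | rfl | rfl | rfl | rfl | rfl | rfl
    · exact h.wch_of_reSum _ (by decide) _ a1
    · exact h.wch_of_reSum _ (by decide) _ a2
    · exact h.wch_of_reSum _ (by decide) _ a3
    · exact h.wch_of_reSum _ (by decide) _ a4
    · exact h.wch_of_reSum _ (by decide) _ a5
    · exact h.wch_of_reSum _ (by decide) _ a6
    · exact h.wch_of_reSum _ (by decide) _ a7
    · exact h.wch_of_reSum _ (by decide) _ a8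
    · exact h.wch_of_reSum _ (by decide) _ a9
    · exact h.wch_of_reSum _ (by decide) _ a10
    · exact h.wch_of_reSum _ (by decide) _ a11
    · exact h.wch_of_reSum _ (by decide) _ a12
    · exact h.wch_of_reSum _ (by decide) _ a13
    · exact h.wch_of_reSum _ (by decide) _ a14
    · exact h.wch_of_reSum _ (by decide) _ a15

end DesignCert

/-! ## §10 INDEXED head predicates (partner ∕ server ∕ sibling searches through the key tree instead of level scans)

A cell agreeing with `Z` off one factor `σ` IS `Z` with its `σ`-letter replaced (`setAt`); so «some present cell agrees with `Z` off `σ` and …»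
ranges over the ALPHABET of the level (the finite set of letters occurring in it) and a tree lookup, not over the level. For RULE D the searches
sit in positive position, so SOUNDNESS of the lookup suffices; for the X ∕ A2I heads they guard universal statements, so the alphabet must be
COMPLETE for the level (decided per support) and the lookup complete (`LevelCert.ne_zero_iff_mem`). Measured: ≈ 7× fewer kernel steps per search. -/

/-- replace the `σ`-letter of a cell. -/
def setAt (Z : MCell) (σ : Fin 4) (x : BPoint) : MCell := fun f => if f = σ then x else Z f

theorem setAt_eq_of_magree {q Z : MCell} {σ : Fin 4} (h : MAgree q Z σ) : setAt Z σ (q σ) = q := by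
  funext f
  by_cases hf : f = σ
  · subst hf; simp [setAt]
  · simp [setAt, hf, h f hf]

/-- membership oracle of a tree: «the lookup finds a non-zero multiplicity». -/
def memOf (t : CT) (q : MCell) : Bool := decide (mT t q ≠ 0)

/-- membership oracle of the DUAL level stored in a tree of the original level. -/
def memOfDual (t : CT) (q : MCell) : Bool := decide (mT t (dualCell 0 q) ≠ 0)

theorem dualCell_dualCell (Z : MCell) : dualCell 0 (dualCell 0 Z) = Z := by
  funext f; exact dualPt_dualPt 0 (Z f)

/-! ### RULE D, indexed service -/

/-- indexed «served below along `(f, k)`». -/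
abbrev ServedBI (mem : MCell → Bool) (alpha : List BPoint) (Z : MCell) (f k : Fin 4) : Prop :=
  ∃ x ∈ alpha, mem (setAt Z f x) = true ∧ UPartner Z (setAt Z f x) f k

/-- indexed «served above along `(f, k)`». -/
abbrev ServedAI (mem : MCell → Bool) (alpha : List BPoint) (P : MCell) (f k : Fin 4) : Prop :=
  ∃ x ∈ alpha, mem (setAt P f x) = true ∧ UPartner (setAt P f x) P f k

/-- RULE D at an `N`-cell with indexed service (covers stay level scans). -/
abbrev RuleDNI (mem : MCell → Bool) (alpha : List BPoint) (C : MConfig) (Z : MCell) : Prop :=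
  ∀ g j : Fin 4, g ≠ j → ∀ k k' : Fin 4, Adapted (Z g) k → Adapted (Z j) k' → coord (Z g) k ≠ coord (Z j) k' →
    (∃ r : Fin 4, r ≠ k + 2 ∧ ServedBI mem alpha Z g r) ∨ (∃ r : Fin 4, r ≠ k' + 2 ∧ ServedBI mem alpha Z j r) ∨ CoveredBelow C Z g k j k'

/-- RULE D at a `P`-cell with indexed service. -/
abbrev RuleDPI (mem : MCell → Bool) (alpha : List BPoint) (C : MConfig) (P : MCell) : Prop :=
  ∀ g j : Fin 4, g ≠ j → ∀ k k' : Fin 4, Adapted (P g) k → Adapted (P j) k' → coord (P g) k ≠ coord (P j) k' →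
    (∃ r : Fin 4, r ≠ k + 2 ∧ ServedAI mem alpha P g r) ∨ (∃ r : Fin 4, r ≠ k' + 2 ∧ ServedAI mem alpha P j r) ∨ CoveredAbove C P g k j k'

theorem ruleDN_of_indexed {mem : MCell → Bool} {alpha : List BPoint} {C : MConfig} (hmem : ∀ q, mem q = true → q ∈ C.upper) {Z : MCell}
    (h : RuleDNI mem alpha C Z) : RuleDMu4N C Z := by
  intro g j hgj k k' hk hk' hc
  rcases h g j hgj k k' hk hk' hc with ⟨r, hr, x, -, hm, hu⟩ | ⟨r, hr, x, -, hm, hu⟩ | hcov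
  · exact Or.inl ⟨r, hr, _, hmem _ hm, hu⟩
  · exact Or.inr (Or.inl ⟨r, hr, _, hmem _ hm, hu⟩)
  · exact Or.inr (Or.inr hcov)

theorem ruleDP_of_indexed {mem : MCell → Bool} {alpha : List BPoint} {C : MConfig} (hmem : ∀ q, mem q = true → q ∈ C.lower) {P : MCell}
    (h : RuleDPI mem alpha C P) : RuleDMu4P C P := by
  intro g j hgj k k' hk hk' hc
  rcases h g j hgj k k' hk hk' hc with ⟨r, hr, x, -, hm, hu⟩ | ⟨r, hr, x, -, hm, hu⟩ | hcov
  · exact Or.inl ⟨r, hr, _, hmem _ hm, hu⟩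
  · exact Or.inr (Or.inl ⟨r, hr, _, hmem _ hm, hu⟩)
  · exact Or.inr (Or.inr hcov)

/-! ### X and A2I heads, indexed partner ∕ sibling ∕ server search -/

/-- X head with indexed partner (`setAt Z σ x`, `x` in the partner-level alphabet) and sibling (`setAt Z σ y`, `y` in the sibling-level alphabet). -/
abbrev XHeadI (memU memL : MCell → Bool) (alphaU alphaL : List BPoint) (D : MConfig) (Z : MCell) : Prop :=
  ∀ σ : Fin 4, ¬ isApex (Z σ) → ∀ x ∈ alphaU, memU (setAt Z σ x) = true → ∀ u : Fin 4, UPartner Z (setAt Z σ x) σ u →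
    ∀ y ∈ alphaL, memL (setAt Z σ y) = true → ∀ w : Fin 4, Sibling (setAt Z σ x) (setAt Z σ y) σ w →
      ∀ f : Fin 4, ¬ XresXFires D Z (setAt Z σ x) (setAt Z σ y) σ u w f

theorem xHead_of_indexed {memU memL : MCell → Bool} {alphaU alphaL : List BPoint} {D : MConfig}
    (hαU : ∀ q ∈ D.upper, ∀ f, q f ∈ alphaU) (hmU : ∀ q ∈ D.upper, memU q = true)
    (hαL : ∀ n ∈ D.lower, ∀ f, n f ∈ alphaL) (hmL : ∀ n ∈ D.lower, memL n = true) {Z : MCell} (h : XHeadI memU memL alphaU alphaL D Z) :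
    XHead D Z := by
  intro q hq n hn σ u w f hF
  have hqZ : MAgree q Z σ := hF.2.2.1.1
  have hnq : MAgree n q σ := hF.2.2.2.2.2.1.1
  have hnZ : MAgree n Z σ := fun g hg => (hnq g hg).trans (hqZ g hg)
  have eq1 : setAt Z σ (q σ) = q := setAt_eq_of_magree hqZ
  have eq2 : setAt Z σ (n σ) = n := setAt_eq_of_magree hnZ
  have h' := h σ hF.1 (q σ) (hαU q hq σ) (by rw [eq1]; exact hmU q hq) u (by rw [eq1]; exact hF.2.2.1) (n σ) (hαL n hn σ)
    (by rw [eq2]; exact hmL n hn) w (by rw [eq1, eq2]; exact hF.2.2.2.2.2.1) f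
  rw [eq1, eq2] at h'
  exact h' hF

/-- A2I head with indexed partner (`setAt Z σ x`) and server (`setAt (setAt Z σ x) f' z`, `z` in the server-level alphabet). -/
abbrev AHeadI (memU memL : MCell → Bool) (alphaU alphaL : List BPoint) (D : MConfig) (Z : MCell) : Prop :=
  ∀ σ : Fin 4, ¬ isApex (Z σ) → ∀ x ∈ alphaU, memU (setAt Z σ x) = true → ∀ u : Fin 4, EncDir (Z σ) u → UPartner Z (setAt Z σ x) σ u →
    ∀ f' : Fin 4, f' ≠ σ → ∀ z ∈ alphaL, memL (setAt (setAt Z σ x) f' z) = true → ∀ v : Fin 4,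
      UPartner (setAt (setAt Z σ x) f' z) (setAt Z σ x) f' v → ¬ XresA2IFires D Z (setAt Z σ x) (setAt (setAt Z σ x) f' z) σ u f' v

theorem aHead_of_indexed {memU memL : MCell → Bool} {alphaU alphaL : List BPoint} {D : MConfig}
    (hαU : ∀ q ∈ D.upper, ∀ f, q f ∈ alphaU) (hmU : ∀ q ∈ D.upper, memU q = true)
    (hαL : ∀ n ∈ D.lower, ∀ f, n f ∈ alphaL) (hmL : ∀ n ∈ D.lower, memL n = true) {Z : MCell} (h : AHeadI memU memL alphaU alphaL D Z) :
    AHead D Z := by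
  intro q hq N' hN σ u f' v hF
  have hqZ : MAgree q Z σ := hF.2.2.1.1
  have hNq : MAgree q N' f' := hF.2.2.2.2.2.1.1
  have eq1 : setAt Z σ (q σ) = q := setAt_eq_of_magree hqZ
  have eq2 : setAt q f' (N' f') = N' := setAt_eq_of_magree (fun g hg => (hNq g hg).symm)
  have h' := h σ hF.1 (q σ) (hαU q hq σ) (by rw [eq1]; exact hmU q hq) u hF.2.1 (by rw [eq1]; exact hF.2.2.1) f' hF.2.2.2.2.1 (N' f')
    (hαL N' hN f') (by rw [eq1, eq2]; exact hmL N' hN) v (by rw [eq1, eq2]; exact hF.2.2.2.2.2.1)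
  rw [eq1, eq2] at h'
  exact h' hF

namespace DesignCert

variable {LN LP : List (MCell × ℤ)} {tN tP : CT}

theorem memOf_upper (h : DesignCert LN LP tN tP) : ∀ q, memOf tP q = true → q ∈ h.cfg.upper := fun q hq =>
  h.mem_upper.2 ((h.certP.ne_zero_iff_mem q).1 (of_decide_eq_true hq))

theorem memOf_lower (h : DesignCert LN LP tN tP) : ∀ q, memOf tN q = true → q ∈ h.cfg.lower := fun q hq =>
  h.mem_lower.2 ((h.certN.ne_zero_iff_mem q).1 (of_decide_eq_true hq))

theorem upper_memOf (h : DesignCert LN LP tN tP) : ∀ q ∈ h.cfg.upper, memOf tP q = true := fun q hq =>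
  decide_eq_true ((h.certP.ne_zero_iff_mem q).2 (h.mem_upper.1 hq))

theorem lower_memOf (h : DesignCert LN LP tN tP) : ∀ q ∈ h.cfg.lower, memOf tN q = true := fun q hq =>
  decide_eq_true ((h.certN.ne_zero_iff_mem q).2 (h.mem_lower.1 hq))

theorem mem_cfgd_upper (h : DesignCert LN LP tN tP) {Z : MCell} : Z ∈ h.cfgd.upper ↔ ∃ N ∈ h.cfg.lower, Z = dualCell 0 N := by
  show Z ∈ (LN.map dualE).map Prod.fst ↔ _
  rw [map_dualE_fst, List.mem_map]
  exact ⟨fun ⟨P, hP, e⟩ => ⟨P, h.mem_lower.2 hP, e.symm⟩, fun ⟨P, hP, e⟩ => ⟨P, h.mem_lower.1 hP, e.symm⟩⟩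

/-- in the dual world: `cfgd.upper` (duals of `N`-cells) through the `N`-tree, `cfgd.lower` (duals of `P`-cells) through the `P`-tree. -/
theorem dupper_memOfDual (h : DesignCert LN LP tN tP) : ∀ q ∈ h.cfgd.upper, memOfDual tN q = true := fun q hq => by
  obtain ⟨N, hN, rfl⟩ := h.mem_cfgd_upper.1 hq
  show decide (mT tN (dualCell 0 (dualCell 0 N)) ≠ 0) = true
  rw [dualCell_dualCell]; exact h.lower_memOf N hN

theorem dlower_memOfDual (h : DesignCert LN LP tN tP) : ∀ q ∈ h.cfgd.lower, memOfDual tP q = true := fun q hq => by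
  obtain ⟨P, hP, rfl⟩ := h.mem_cfgd_lower.1 hq
  show decide (mT tP (dualCell 0 (dualCell 0 P)) ≠ 0) = true
  rw [dualCell_dualCell]; exact h.upper_memOf P hP

/-- alphabet completeness of a level from the decided Boolean over its list. -/
theorem alpha_upper (h : DesignCert LN LP tN tP) (alpha : List BPoint) (hb : allB LP (fun p => decide (∀ f, p.1 f ∈ alpha)) = true) :
    ∀ q ∈ h.cfg.upper, ∀ f, q f ∈ alpha := fun q hq => by
  obtain ⟨p, hp, rfl⟩ := List.mem_map.1 (h.mem_upper.1 hq); exact forall_of_allB hb p hp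

theorem alpha_lower (h : DesignCert LN LP tN tP) (alpha : List BPoint) (hb : allB LN (fun p => decide (∀ f, p.1 f ∈ alpha)) = true) :
    ∀ q ∈ h.cfg.lower, ∀ f, q f ∈ alpha := fun q hq => by
  obtain ⟨p, hp, rfl⟩ := List.mem_map.1 (h.mem_lower.1 hq); exact forall_of_allB hb p hp

theorem alpha_dupper (h : DesignCert LN LP tN tP) (alpha : List BPoint) (hb : allB LN (fun p => decide (∀ f, p.1 f ∈ alpha)) = true) :
    ∀ q ∈ h.cfgd.upper, ∀ f, q f ∈ alpha.map (dualPt 0) := fun q hq f => by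
  obtain ⟨N, hN, rfl⟩ := h.mem_cfgd_upper.1 hq
  exact List.mem_map.2 ⟨N f, h.alpha_lower alpha hb N hN f, rfl⟩

theorem alpha_dlower (h : DesignCert LN LP tN tP) (alpha : List BPoint) (hb : allB LP (fun p => decide (∀ f, p.1 f ∈ alpha)) = true) :
    ∀ q ∈ h.cfgd.lower, ∀ f, q f ∈ alpha.map (dualPt 0) := fun q hq f => by
  obtain ⟨P, hP, rfl⟩ := h.mem_cfgd_lower.1 hq
  exact List.mem_map.2 ⟨P f, h.alpha_upper alpha hb P hP f, rfl⟩

/-- **RULE D at every `N`-cell from INDEXED heads at the representatives.** -/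
theorem ruleDN_of_repsI (h : DesignCert LN LP tN tP) {repsN : List (MCell × ℤ)} {csN : List ℕ} (hLN : LN = genList repsN csN)
    (alpha : List BPoint) (hN : ∀ R ∈ repsN, RuleDNI (memOf tP) alpha h.cfg R.1) : ∀ Z ∈ h.cfg.lower, RuleDMu4N h.cfg Z :=
  h.ruleDN_of_reps hLN fun R hR => ruleDN_of_indexed h.memOf_upper (hN R hR)

/-- **RULE D at every `P`-cell from INDEXED heads at the representatives.** -/
theorem ruleDP_of_repsI (h : DesignCert LN LP tN tP) {repsP : List (MCell × ℤ)} {csP : List ℕ} (hLP : LP = genList repsP csP)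
    (alpha : List BPoint) (hP : ∀ R ∈ repsP, RuleDPI (memOf tN) alpha h.cfg R.1) : ∀ P ∈ h.cfg.upper, RuleDMu4P h.cfg P :=
  h.ruleDP_of_reps hLP fun R hR => ruleDP_of_indexed h.memOf_lower (hP R hR)

/-- **X⁺ CLOSED from INDEXED X-heads at the duals of the `P`-representatives** (dual world: partners among the duals of the `N`-cells,
siblings among the duals of the `P`-cells; alphabets = duals of the `N`- resp. `P`-alphabet). -/
theorem xPlusClosed_of_repsI (h : DesignCert LN LP tN tP) {repsP : List (MCell × ℤ)} {csP : List ℕ} (hLP : LP = genList repsP csP)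
    (alphaN alphaP : List BPoint) (hαN : allB LN (fun p => decide (∀ f, p.1 f ∈ alphaN)) = true)
    (hαP : allB LP (fun p => decide (∀ f, p.1 f ∈ alphaP)) = true)
    (hX : ∀ R ∈ repsP, XHeadI (memOfDual tN) (memOfDual tP) (alphaN.map (dualPt 0)) (alphaP.map (dualPt 0)) h.cfgd (dualCell 0 R.1)) :
    XPlusClosed h.cfg := by
  show XresXClosed (h.cfg.dual 0)
  rw [h.dual_eq]
  refine xresXClosed_of_heads fun Z hZ => ?_
  obtain ⟨P, hP, rfl⟩ := h.mem_cfgd_lower.1 hZ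
  obtain ⟨Rm, hR, σ, j, rfl⟩ := h.coverP hLP hP
  rw [dualCell_deltaIter_perm]
  exact xHead_orbit h.cfgd h.g1c_dual _ (xHead_of_indexed (h.alpha_dupper alphaN hαN) h.dupper_memOfDual (h.alpha_dlower alphaP hαP)
    h.dlower_memOfDual (hX Rm hR)) σ j

/-- **X⁻ CLOSED from INDEXED X-heads at the `N`-representatives.** -/
theorem xMinusClosed_of_repsI (h : DesignCert LN LP tN tP) {repsN : List (MCell × ℤ)} {csN : List ℕ} (hLN : LN = genList repsN csN)
    (alphaN alphaP : List BPoint) (hαN : allB LN (fun p => decide (∀ f, p.1 f ∈ alphaN)) = true)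
    (hαP : allB LP (fun p => decide (∀ f, p.1 f ∈ alphaP)) = true)
    (hX : ∀ R ∈ repsN, XHeadI (memOf tP) (memOf tN) alphaP alphaN h.cfg R.1) : XMinusClosed h.cfg := by
  refine xresXClosed_of_heads fun Z hZ => ?_
  obtain ⟨Rm, hR, σ, j, rfl⟩ := h.coverN hLN hZ
  exact xHead_orbit h.cfg h.g1c _ (xHead_of_indexed (h.alpha_upper alphaP hαP) h.upper_memOf (h.alpha_lower alphaN hαN) h.lower_memOf
    (hX Rm hR)) σ j

/-- **A2I⁻ CLOSED from INDEXED A2I-heads at the `N`-representatives.** -/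
theorem a2iMinusClosed_of_repsI (h : DesignCert LN LP tN tP) {repsN : List (MCell × ℤ)} {csN : List ℕ} (hLN : LN = genList repsN csN)
    (alphaN alphaP : List BPoint) (hαN : allB LN (fun p => decide (∀ f, p.1 f ∈ alphaN)) = true)
    (hαP : allB LP (fun p => decide (∀ f, p.1 f ∈ alphaP)) = true)
    (hA : ∀ R ∈ repsN, AHeadI (memOf tP) (memOf tN) alphaP alphaN h.cfg R.1) : A2IMinusClosed h.cfg := by
  refine xresA2IClosed_of_heads fun Z hZ => ?_
  obtain ⟨Rm, hR, σ, j, rfl⟩ := h.coverN hLN hZ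
  exact aHead_orbit h.cfg h.g1c _ (aHead_of_indexed (h.alpha_upper alphaP hαP) h.upper_memOf (h.alpha_lower alphaN hαN) h.lower_memOf
    (hA Rm hR)) σ j

/-- **A2I⁺ CLOSED from INDEXED A2I-heads at the duals of the `P`-representatives.** -/
theorem a2iPlusClosed_of_repsI (h : DesignCert LN LP tN tP) {repsP : List (MCell × ℤ)} {csP : List ℕ} (hLP : LP = genList repsP csP)
    (alphaN alphaP : List BPoint) (hαN : allB LN (fun p => decide (∀ f, p.1 f ∈ alphaN)) = true)
    (hαP : allB LP (fun p => decide (∀ f, p.1 f ∈ alphaP)) = true)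
    (hA : ∀ R ∈ repsP, AHeadI (memOfDual tN) (memOfDual tP) (alphaN.map (dualPt 0)) (alphaP.map (dualPt 0)) h.cfgd (dualCell 0 R.1)) :
    A2IPlusClosed h.cfg := by
  show XresA2IClosed (h.cfg.dual 0)
  rw [h.dual_eq]
  refine xresA2IClosed_of_heads fun Z hZ => ?_
  obtain ⟨P, hP, rfl⟩ := h.mem_cfgd_lower.1 hZ
  obtain ⟨Rm, hR, σ, j, rfl⟩ := h.coverP hLP hP
  rw [dualCell_deltaIter_perm]
  exact aHead_orbit h.cfgd h.g1c_dual _ (aHead_of_indexed (h.alpha_dupper alphaN hαN) h.dupper_memOfDual (h.alpha_dlower alphaP hαP)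
    h.dlower_memOfDual (hA Rm hR)) σ j

end DesignCert

end Summit.HodgeConjecture.HodgeConjecture.Cruxes.BlochSeedDiscOne.DesignKernel
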